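import Literature.MathematicalPhysics.QuantumFieldTheory.TomboulisConfinementClaim
import Literature.MathematicalPhysics.QuantumFieldTheory.MullerSchiemann1987.MS87ClassFunctionsSU2
import Literature.Barriers.QuantumFields.MigdalKadanoffGroupBlindnessDischarge
import HarnessLib

/-!
# Ito's theorem for `SU(2)`, `D = 4`: the Migdal–Kadanoff recursion drives Wilson's action to strong coupling — the named fact `Tomboulis2007.itoTheoremSU2` DISCHARGED

statement-level skeleton of published theorems with citation tags; proofs where landed; nothing here is a claim
about the Yang–Mills mass gap (the Migdal–Kadanoff recursion is a hierarchical APPROXIMATION, not lattice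
Yang–Mills; see the honest-framing paragraph of `TomboulisConfinementClaim.lean`, Revision 1).

This file PROVES `Literature.MathematicalPhysics.QuantumFieldTheory.Tomboulis2007.itoTheoremSU2`
(`TomboulisConfinementClaim.lean`, Revision 1): for every integer scale factor `b ≥ 2` and every `β > 0` the
iterates `f⁽ⁿ⁾ = mkIterFun b n (wilsonPlaqFn β)` of the standard (`r = 1`) `D = 4` Migdal–Kadanoff recursion
`f ↦ (f^{b²})^{⋆b²}/∫(f^{b²})^{⋆b²}` on `SU(2)` class functions, started at Wilson's plaquette function
`e^{β Re tr U}/∫ e^{β Re tr}`, satisfy `charCoeff f⁽ⁿ⁾ j → 0` for every `j ≠ 0` (Ito, PRL 55 (1985) 558, as quoted in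
Ito–Seiler 2007 Thm. 2.1: «For `D ≤ 4` and for `G = SU(N)` or `G = U(N)`, `lim c_j(n) = 0` for `j ≠ 0`» — here the
`SU(2)` instance). The theorem is `Tomboulis2007.itoTheoremSU2_holds`; the `U(1)` half is the tree's
`Literature.Barriers.QuantumFields.MigdalKadanoffGroupBlindness_holds`. No definition and no named fact is
introduced; every auxiliary statement is a theorem proved here.

## The printed proof and how it is followed

K. R. Ito, *Mass generations in two-dimensional hierarchical Heisenberg model of Migdal–Kadanoff type*, Commun.
Math. Phys. **110** (1987) 237–246 [Ito1987HierarchicalHeisenberg] (held, Project Euclid; pp. 242–243 read), §3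
«Proof of the Main Theorem», eqs. (13)–(24), is the local-curvature Lyapunov argument at the CRITICAL dimension,
printed for `S²`-valued spins («easily extended to the N-vector model», p. 239) and, by its Remark 1 (p. 241), for
the gauge case where «`{g⁽ⁿ⁾(v)}` are class functions of `G`», i.e. the setting of PRL 55 (1985) 558. The `2D`
spin recursion of Kadanoff type with `r` bonds is the `4D` gauge recursion with `b² = r` (power `b^{D-2} = b²`, then
`b²` convolutions), which is the tree's `mkStepFun`. The steps, with the printed equation they formalise:

* (13)–(15) the local curvature of the effective action along one-parameter translates and its maximum: here the
  LEFT fibres `s ↦ F(e^{-isσ₃} g)` along the subgroup `diagPhase` of `MS87HeatKernelGroup` (for a class function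
  every one-parameter direction at every point is conjugate to this one), with the curvature
  `b_F = (F₁² - F₂F)/F²` of explicit fibre derivatives `F₁, F₂` (§1) and a bound `b_F ≤ B` carried as data;
* (19) the bond-moving power multiplies the curvature by `b²` (`curv_pow`), and a convolution `K = P ⋆ Q` splits
  its translation between the factors, `K(e^{-isσ₃}g) = ∫ P(e^{-iαsσ₃} gV⁻¹) Q(e^{-i(1-α)sσ₃} V) dV` (Haar
  substitution and centrality of `P`: `convSU2_fibre_split`, differentiated twice under the integral sign:
  `convSU2_one_split`, `convSU2_two_split`);
* (20) Cauchy–Schwarz: `b_K ≤ E[α² b_P + (1-α)² b_Q]` (`curv_convSU2'`); with `α = k/(k+1)` along the `b²`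
  convolutions the factors `b² · (1/b²)` cancel exactly — the marginality of `D = 4` (`convPow_spec`);
* (21) and the remark after it («`β` is a periodic function of `θ` such that `∫ β dθ = 0`»): the curvature has ZERO
  HAAR MEAN (`integral_fibreDeriv_eq_zero`, `integral_curv_eq_zero`: invariance of Haar measure under the fibre
  translations), whence the strict gain `b_K ≤ α²(1-ρ)B_P + (1-α)²B_Q`, `ρ = min P min Q/(max P max Q)`
  (`curv_convSU2`);
* (24) (and Prop. 2 (9)) `max F · e^{-Bπ²/2} ≤ F ≤ max F` (`exists_bounds_of_curv`: a class function is a function of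
  the central angle, Müller–Schiemann (2.16), so this is the one-dimensional lemma of the `U(1)` file);
* (22)–(23) `B_{n+1} ≤ (1 - ½ e^{-b⁴B_nπ²/2}) B_n`, hence `B_n ≤ 2β qⁿ → 0` with `q = 1 - ½e^{-b⁴βπ²} < 1`
  (`mkStep_spec`, `mkIterFun_spec`; Ito argues by contradiction from monotonicity and a uniform-continuity
  Proposition 3 — the quantitative form used here, as in the `U(1)` file, needs no Proposition 3);
* Thm. 4 (2) with §4 (25)–(26): `|c_j(n)| ≤ C_j (1 - e^{-B_nπ²/2}) → 0` (`abs_charCoeff_le`), using `∫ χ_j dHaar = 0`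
  for `j ≠ 0` (`integral_su2Char_eq_zero`, Bröcker–tom Dieck II (4.11); proved here inside `Literature/` by a Stein
  identity along the fibres, the exchangeability of the three imaginary quaternion coordinates under an inner
  automorphism, and Mathlib's differential equation of the Chebyshev polynomials `U_n`).

Deviations from the print (declared): (a) quantitative contraction instead of Ito's compactness/contradiction
argument (shorter, same inequalities); (b) the recursion is normalised at each step (the tree's `mkStepFun`), which
changes neither curvatures nor `min/max`; (c) only `G = SU(2)`, `D = 4`, `r = 1`, Wilson datum, integer `b ≥ 2` —
exactly the tree's statement `itoTheoremSU2` (`-- TODO(general form): SU(N), U(N), D ≤ 3`, as recorded there).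

## References

* K. R. Ito, Commun. Math. Phys. **110** (1987) 237–246 [Ito1987HierarchicalHeisenberg], §2 (1a)–(2b), §3 (13)–(24),
  Thm. 4, §4 (25)–(26), §5.
* K. R. Ito, Phys. Rev. Lett. **55** (1985) 558 [Ito1985MKConfinement] — the primary announcement (not held; cited
  through Ito 1987 ref. [11] and Ito–Seiler 2007 Thm. 2.1).
* K. R. Ito, E. Seiler, arXiv:0711.4930 [ItoSeiler2007Tomboulis], §2 (2.1a)–(2.3), Thm. 2.1.
* Th. Bröcker, T. tom Dieck, *Representations of Compact Lie Groups* (1985) [BrockerTomDieck1985], II (4.11), II §5.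
* Tree: `TomboulisConfinementClaim.lean` (the recursion and the fact), `MigdalKadanoffGroupBlindnessDischarge.lean`
  (the `U(1)` template; its `Ito.NiceFun`, `Ito.exists_bounds_of_curv` are reused), `MullerSchiemann1987/`
  (`diagPhase`, `u0`, `u3`, class functions of the central angle), `QuantumLattice/HeatKernelGroupConvolutionProofs`
  (`haarConv`), `QuantumLattice/SU2Haar` (rows of `SU(2)` matrices).
-/

noncomputable section

open Real MeasureTheory Set Filter Function
open scoped Topology

namespace Literature.MathematicalPhysics.QuantumFieldTheory

namespace Tomboulis2007

namespace ItoSU2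

open MullerSchiemann1987.HeatKernel (diagPhase diagPhase_add diagPhase_zero u0 u3 u0_diagPhase_mul
  u3_diagPhase_mul trace_re_div_two continuous_u0 continuous_u3 abs_u0_le_one normSq_add_normSq)
open MullerSchiemann1987.ClassFunctionsSU2 (continuous_diagPhase eq216 eq216_arccos angular_even
  angular_periodic u0_conj)
open Literature.Barriers.QuantumFields.MigdalKadanoff (Ito.NiceFun Ito.exists_bounds_of_curv)
open Literature.MathematicalPhysics.QuantumLattice (su2_apply_10 su2_apply_11)

/-! ### §1. Calculus along the left `σ₃`-fibres `s ↦ F(e^{-isσ₃} g)` -/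

/-- A continuous function on `SU(2)` is Haar-integrable. [folklore] -/
private theorem integrable_of_continuous {f : SU2 → ℝ} (hf : Continuous f) :
    Integrable f (haarProbability SU2) :=
  hf.integrable_of_hasCompactSupport (HasCompactSupport.of_compactSpace _)

/-- Re-basing a fibre: `e^{-itσ₃} g = e^{-i(t-s)σ₃} (e^{-isσ₃} g)`. [folklore] -/
private theorem diagPhase_mul_rebase (t s : ℝ) (g : SU2) :
    diagPhase t * g = diagPhase (t - s) * (diagPhase s * g) := by
  rw [← mul_assoc, ← diagPhase_add, sub_add_cancel]

/-- The inverse of `e^{-ixσ₃}` is `e^{ixσ₃}`. [folklore] -/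
private theorem diagPhase_inv (x : ℝ) : (diagPhase x)⁻¹ = diagPhase (-x) := by
  rw [inv_eq_iff_mul_eq_one, ← diagPhase_add, add_neg_cancel, diagPhase_zero]

/-- Power rule along fibres, first derivative. [folklore] -/
private theorem hasDerivAt_fibre_pow {F F₁ : SU2 → ℝ} (m : ℕ)
    (h : ∀ (g : SU2) (s : ℝ), HasDerivAt (fun t => F (diagPhase t * g)) (F₁ (diagPhase s * g)) s)
    (g : SU2) (s : ℝ) :
    HasDerivAt (fun t => F (diagPhase t * g) ^ m)
      ((m : ℝ) * F (diagPhase s * g) ^ (m - 1) * F₁ (diagPhase s * g)) s := by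
  simpa using (h g s).fun_pow m

/-- **Differentiation under the Haar integral** (dominated convergence with a uniform bound from
compactness): if `Φ`, `Φ'` are jointly continuous on `ℝ × SU(2)` and `∂_s Φ(s, V) = Φ'(s, V)`, then
`s ↦ ∫ Φ(s, V) dV` has derivative `∫ Φ'(s₀, V) dV` at `s₀`. [folklore] -/
private theorem hasDerivAt_integral_haar {Φ Φ' : ℝ → SU2 → ℝ}
    (hΦ : Continuous fun p : ℝ × SU2 => Φ p.1 p.2)
    (hΦ' : Continuous fun p : ℝ × SU2 => Φ' p.1 p.2)
    (hd : ∀ (s : ℝ) (V : SU2), HasDerivAt (fun t => Φ t V) (Φ' s V) s) (s₀ : ℝ) :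
    HasDerivAt (fun s => ∫ V, Φ s V ∂(haarProbability SU2))
      (∫ V, Φ' s₀ V ∂(haarProbability SU2)) s₀ := by
  have hK : IsCompact (Icc (s₀ - 1) (s₀ + 1) ×ˢ (univ : Set SU2)) :=
    isCompact_Icc.prod isCompact_univ
  obtain ⟨C, hC⟩ := hK.exists_bound_of_continuousOn hΦ'.continuousOn
  have hcs : ∀ s, Continuous fun V => Φ s V := fun s =>
    hΦ.comp (continuous_const.prodMk continuous_id)
  have hcs' : ∀ s, Continuous fun V => Φ' s V := fun s =>
    hΦ'.comp (continuous_const.prodMk continuous_id)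
  refine (hasDerivAt_integral_of_dominated_loc_of_deriv_le (μ := haarProbability SU2)
    (F := Φ) (F' := Φ') (x₀ := s₀) (s := Metric.ball s₀ 1) (bound := fun _ => C)
    (Metric.ball_mem_nhds s₀ one_pos) ?_ ?_ ?_ ?_ ?_ ?_).2
  · exact Eventually.of_forall fun s => (hcs s).aestronglyMeasurable
  · exact integrable_of_continuous (hcs s₀)
  · exact (hcs' s₀).aestronglyMeasurable
  · refine ae_of_all _ fun V s hs => ?_
    have hs' : s ∈ Icc (s₀ - 1) (s₀ + 1) := by
      rw [Metric.mem_ball, Real.dist_eq] at hs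
      constructor <;> linarith [abs_lt.mp hs]
    exact hC (s, V) ⟨hs', mem_univ _⟩
  · exact integrable_const C
  · exact ae_of_all _ fun V s _ => hd s V


/-! ### §2. Zero Haar mean of fibre derivatives; convolution along fibres; the split (Ito (19)) -/

/-- **Zero Haar mean of a fibre derivative**: if `∂_s F(e^{-isσ₃} g) = F₁(e^{-isσ₃} g)` with `F, F₁`
continuous, then `∫ F₁ dHaar = 0` (the Haar measure is invariant under the left translations
`g ↦ e^{-isσ₃} g`, so `s ↦ ∫ F(e^{-isσ₃} g) dg` is constant) — the group form of Ito's remark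
«β is a periodic function of θ such that ∫ β dθ = 0». [cite: Ito1987HierarchicalHeisenberg, §3 after eq. (21)] -/
theorem integral_fibreDeriv_eq_zero {F F₁ : SU2 → ℝ} (hF : Continuous F) (hF₁ : Continuous F₁)
    (h : ∀ (g : SU2) (s : ℝ), HasDerivAt (fun t => F (diagPhase t * g)) (F₁ (diagPhase s * g)) s) :
    ∫ g, F₁ g ∂(haarProbability SU2) = 0 := by
  have hD := hasDerivAt_integral_haar (Φ := fun s g => F (diagPhase s * g))
    (Φ' := fun s g => F₁ (diagPhase s * g))
    (hF.comp ((continuous_diagPhase.comp continuous_fst).mul continuous_snd))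
    (hF₁.comp ((continuous_diagPhase.comp continuous_fst).mul continuous_snd))
    (fun s V => h V s) 0
  have hconst : (fun s : ℝ => ∫ g, F (diagPhase s * g) ∂(haarProbability SU2)) =
      fun _ => ∫ g, F g ∂(haarProbability SU2) := by
    funext s
    exact integral_mul_left_eq_self (μ := haarProbability SU2) (fun g => F g) (diagPhase s)
  rw [hconst] at hD
  have h0 := hD.unique (hasDerivAt_const (0 : ℝ) _)
  simpa [diagPhase_zero] using h0

/-- A class function takes the same value on `AB` and `BA`. [folklore] -/
private theorem central_mul_comm {P : SU2 → ℝ} (hP : ∀ u v : SU2, P (v * u * v⁻¹) = P u) (A B : SU2) :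
    P (A * B) = P (B * A) := by
  have h := hP (A * B) B
  rw [← mul_assoc, mul_inv_cancel_right] at h
  exact h.symm

/-- `convSU2 P Q` is the tree's `haarConv P Q` (second convolution formula). [folklore] -/
private theorem convSU2_eq_haarConv (P Q : SU2 → ℝ) :
    convSU2 P Q = Literature.MathematicalPhysics.QuantumLattice.haarConv P Q := by
  funext U
  rw [Literature.MathematicalPhysics.QuantumLattice.haarConv_eq_integral_mul_inv]
  rfl

/-- Continuity of `convSU2 P Q` for continuous `P`, `Q`. [folklore] -/
private theorem continuous_convSU2 {P Q : SU2 → ℝ} (hP : Continuous P) (hQ : Continuous Q) :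
    Continuous (convSU2 P Q) := by
  rw [convSU2_eq_haarConv]
  exact Literature.MathematicalPhysics.QuantumLattice.continuous_haarConv hP
    (integrable_of_continuous hQ)

/-- **Fibre derivative of a convolution**: `∂_s (P ⋆ Q)(e^{-isσ₃} g) = (P₁ ⋆ Q)(e^{-isσ₃} g)` — the
translation acts on the left factor only. [folklore] -/
private theorem hasDerivAt_fibre_convSU2 {P P₁ Q : SU2 → ℝ} (hP : Continuous P) (hP₁ : Continuous P₁)
    (hQ : Continuous Q)
    (h : ∀ (g : SU2) (s : ℝ), HasDerivAt (fun t => P (diagPhase t * g)) (P₁ (diagPhase s * g)) s)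
    (g : SU2) (s : ℝ) :
    HasDerivAt (fun t => convSU2 P Q (diagPhase t * g)) (convSU2 P₁ Q (diagPhase s * g)) s := by
  have hc : Continuous fun p : ℝ × SU2 => diagPhase p.1 * g * p.2⁻¹ :=
    ((continuous_diagPhase.comp continuous_fst).mul continuous_const).mul
      (continuous_snd.inv)
  have hD := hasDerivAt_integral_haar (Φ := fun t V => P (diagPhase t * g * V⁻¹) * Q V)
    (Φ' := fun t V => P₁ (diagPhase t * g * V⁻¹) * Q V)
    ((hP.comp hc).mul (hQ.comp continuous_snd)) ((hP₁.comp hc).mul (hQ.comp continuous_snd))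
    (fun t V => by
      have h1 := (h (g * V⁻¹) t).mul_const (Q V)
      simpa only [mul_assoc] using h1) s
  exact hD

/-- **The split** (substituting `V ↦ e^{-i(1-α)sσ₃} V` and using centrality of `P`): for a class
function `P`, `(P ⋆ Q)(e^{-isσ₃} g) = ∫ P(e^{-iαsσ₃} g V⁻¹) Q(e^{-i(1-α)sσ₃} V) dV` — the translation is
shared between the two factors in the ratio `α : 1 - α` (Ito's device behind eq. (19)).
[cite: Ito1987HierarchicalHeisenberg, §3 eq. (19)] -/
theorem convSU2_fibre_split {P Q : SU2 → ℝ} (hP : ∀ u v : SU2, P (v * u * v⁻¹) = P u)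
    (g : SU2) (α s : ℝ) :
    convSU2 P Q (diagPhase s * g) =
      ∫ V, P (diagPhase (α * s) * g * V⁻¹) * Q (diagPhase ((1 - α) * s) * V)
        ∂(haarProbability SU2) := by
  set c := (1 - α) * s with hc
  show (∫ V, P (diagPhase s * g * V⁻¹) * Q V ∂(haarProbability SU2)) = _
  rw [← integral_mul_left_eq_self (μ := haarProbability SU2)
    (fun V => P (diagPhase s * g * V⁻¹) * Q V) (diagPhase c)]
  refine integral_congr_ae (Eventually.of_forall fun V => ?_)
  show P (diagPhase s * g * (diagPhase c * V)⁻¹) * Q (diagPhase c * V) = _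
  congr 1
  rw [mul_inv_rev, diagPhase_inv, ← mul_assoc, central_mul_comm hP, ← mul_assoc, ← mul_assoc,
    ← diagPhase_add]
  congr 2
  rw [hc]
  ring

/-- Chain rule for a rescaled fibre `s ↦ F(e^{-iαsσ₃} h)`. [folklore] -/
private theorem hasDerivAt_fibre_scaled {F F₁ : SU2 → ℝ}
    (h : ∀ (g : SU2) (s : ℝ), HasDerivAt (fun t => F (diagPhase t * g)) (F₁ (diagPhase s * g)) s)
    (hh : SU2) (α s : ℝ) :
    HasDerivAt (fun t => F (diagPhase (α * t) * hh)) (α * F₁ (diagPhase (α * s) * hh)) s := by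
  have h1 := h hh (α * s)
  have h2 : HasDerivAt (fun t : ℝ => α * t) α s := by
    simpa using (hasDerivAt_id s).const_mul α
  have h3 : HasDerivAt (fun t => F (diagPhase (α * t) * hh)) (F₁ (diagPhase (α * s) * hh) * α) s :=
    h1.comp s h2
  rw [mul_comm]
  exact h3

/-- **First fibre derivative of a convolution in split form**: for a class function `P`,
`(P₁ ⋆ Q)(g) = ∫ [α P₁(gV⁻¹) Q(V) + (1-α) P(gV⁻¹) Q₁(V)] dV`. [cite: Ito1987HierarchicalHeisenberg, §3 eq. (19)] -/
theorem convSU2_deriv_split {P P₁ Q Q₁ : SU2 → ℝ} (hPc : ∀ u v : SU2, P (v * u * v⁻¹) = P u)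
    (hP : Continuous P) (hP₁ : Continuous P₁) (hQ : Continuous Q) (hQ₁ : Continuous Q₁)
    (hdP : ∀ (g : SU2) (s : ℝ), HasDerivAt (fun t => P (diagPhase t * g)) (P₁ (diagPhase s * g)) s)
    (hdQ : ∀ (g : SU2) (s : ℝ), HasDerivAt (fun t => Q (diagPhase t * g)) (Q₁ (diagPhase s * g)) s)
    (g : SU2) (α s : ℝ) :
    HasDerivAt (fun t => convSU2 P Q (diagPhase t * g))
      (∫ V, (α * P₁ (diagPhase (α * s) * g * V⁻¹) * Q (diagPhase ((1 - α) * s) * V) +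
        (1 - α) * (P (diagPhase (α * s) * g * V⁻¹) * Q₁ (diagPhase ((1 - α) * s) * V)))
        ∂(haarProbability SU2)) s := by
  have hfun : (fun t => convSU2 P Q (diagPhase t * g)) = fun t =>
      ∫ V, P (diagPhase (α * t) * g * V⁻¹) * Q (diagPhase ((1 - α) * t) * V)
        ∂(haarProbability SU2) := funext fun t => convSU2_fibre_split hPc g α t
  rw [hfun]
  have hc1 : Continuous fun p : ℝ × SU2 => diagPhase (α * p.1) * g * p.2⁻¹ :=
    ((continuous_diagPhase.comp (continuous_const.mul continuous_fst)).mul continuous_const).mul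
      continuous_snd.inv
  have hc2 : Continuous fun p : ℝ × SU2 => diagPhase ((1 - α) * p.1) * p.2 :=
    (continuous_diagPhase.comp (continuous_const.mul continuous_fst)).mul continuous_snd
  refine hasDerivAt_integral_haar
    (Φ := fun t V => P (diagPhase (α * t) * g * V⁻¹) * Q (diagPhase ((1 - α) * t) * V))
    (Φ' := fun t V => α * P₁ (diagPhase (α * t) * g * V⁻¹) * Q (diagPhase ((1 - α) * t) * V) +
        (1 - α) * (P (diagPhase (α * t) * g * V⁻¹) * Q₁ (diagPhase ((1 - α) * t) * V)))
    ((hP.comp hc1).mul (hQ.comp hc2)) ?_ ?_ s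
  · exact ((continuous_const.mul (hP₁.comp hc1)).mul (hQ.comp hc2)).add
      (continuous_const.mul ((hP.comp hc1).mul (hQ₁.comp hc2)))
  · intro t V
    have h1 := hasDerivAt_fibre_scaled hdP (g * V⁻¹) α t
    have h2 := hasDerivAt_fibre_scaled hdQ V (1 - α) t
    have h3 := h1.mul h2
    refine h3.congr_of_eventuallyEq (Eventually.of_forall fun u => ?_) |>.congr_deriv ?_
    · simp only [Pi.mul_apply, mul_assoc]
    · simp only [mul_assoc]
      ring


/-- The first split as an identity of functions of the fibre parameter. [cite: Ito1987HierarchicalHeisenberg, §3 eq. (19)] -/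
theorem convSU2_deriv_split_eq {P P₁ Q Q₁ : SU2 → ℝ} (hPc : ∀ u v : SU2, P (v * u * v⁻¹) = P u)
    (hP : Continuous P) (hP₁ : Continuous P₁) (hQ : Continuous Q) (hQ₁ : Continuous Q₁)
    (hdP : ∀ (g : SU2) (s : ℝ), HasDerivAt (fun t => P (diagPhase t * g)) (P₁ (diagPhase s * g)) s)
    (hdQ : ∀ (g : SU2) (s : ℝ), HasDerivAt (fun t => Q (diagPhase t * g)) (Q₁ (diagPhase s * g)) s)
    (g : SU2) (α t : ℝ) :
    convSU2 P₁ Q (diagPhase t * g) =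
      ∫ V, (α * P₁ (diagPhase (α * t) * g * V⁻¹) * Q (diagPhase ((1 - α) * t) * V) +
        (1 - α) * (P (diagPhase (α * t) * g * V⁻¹) * Q₁ (diagPhase ((1 - α) * t) * V)))
        ∂(haarProbability SU2) :=
  (hasDerivAt_fibre_convSU2 hP hP₁ hQ hdP g t).unique (convSU2_deriv_split hPc hP hP₁ hQ hQ₁ hdP hdQ g α t)

/-- **`(P₁ ⋆ Q)(g) = ∫ [α P₁(gV⁻¹) Q(V) + (1-α) P(gV⁻¹) Q₁(V)] dV`** for a class function `P`.
[cite: Ito1987HierarchicalHeisenberg, §3 eq. (19)] -/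
theorem convSU2_one_split {P P₁ Q Q₁ : SU2 → ℝ} (hPc : ∀ u v : SU2, P (v * u * v⁻¹) = P u)
    (hP : Continuous P) (hP₁ : Continuous P₁) (hQ : Continuous Q) (hQ₁ : Continuous Q₁)
    (hdP : ∀ (g : SU2) (s : ℝ), HasDerivAt (fun t => P (diagPhase t * g)) (P₁ (diagPhase s * g)) s)
    (hdQ : ∀ (g : SU2) (s : ℝ), HasDerivAt (fun t => Q (diagPhase t * g)) (Q₁ (diagPhase s * g)) s)
    (g : SU2) (α : ℝ) :
    convSU2 P₁ Q g =
      ∫ V, (α * (P₁ (g * V⁻¹) * Q V) + (1 - α) * (P (g * V⁻¹) * Q₁ V)) ∂(haarProbability SU2) := by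
  have h := convSU2_deriv_split_eq hPc hP hP₁ hQ hQ₁ hdP hdQ g α 0
  simpa [diagPhase_zero, mul_assoc] using h

/-- **`(P₂ ⋆ Q)(g) = ∫ [α² P₂(gV⁻¹) Q(V) + 2α(1-α) P₁(gV⁻¹) Q₁(V) + (1-α)² P(gV⁻¹) Q₂(V)] dV`** for a
class function `P` (differentiate the first split once more under the integral sign).
[cite: Ito1987HierarchicalHeisenberg, §3 eq. (19)] -/
theorem convSU2_two_split {P P₁ P₂ Q Q₁ Q₂ : SU2 → ℝ} (hPc : ∀ u v : SU2, P (v * u * v⁻¹) = P u)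
    (hP : Continuous P) (hP₁ : Continuous P₁) (hP₂ : Continuous P₂) (hQ : Continuous Q)
    (hQ₁ : Continuous Q₁) (hQ₂ : Continuous Q₂)
    (hdP : ∀ (g : SU2) (s : ℝ), HasDerivAt (fun t => P (diagPhase t * g)) (P₁ (diagPhase s * g)) s)
    (hdP' : ∀ (g : SU2) (s : ℝ), HasDerivAt (fun t => P₁ (diagPhase t * g)) (P₂ (diagPhase s * g)) s)
    (hdQ : ∀ (g : SU2) (s : ℝ), HasDerivAt (fun t => Q (diagPhase t * g)) (Q₁ (diagPhase s * g)) s)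
    (hdQ' : ∀ (g : SU2) (s : ℝ), HasDerivAt (fun t => Q₁ (diagPhase t * g)) (Q₂ (diagPhase s * g)) s)
    (g : SU2) (α : ℝ) :
    convSU2 P₂ Q g =
      ∫ V, (α ^ 2 * (P₂ (g * V⁻¹) * Q V) + 2 * α * (1 - α) * (P₁ (g * V⁻¹) * Q₁ V) +
        (1 - α) ^ 2 * (P (g * V⁻¹) * Q₂ V)) ∂(haarProbability SU2) := by
  -- the first split, as a function of the fibre parameter
  have hfun : (fun t => convSU2 P₁ Q (diagPhase t * g)) = fun t =>
      ∫ V, (α * P₁ (diagPhase (α * t) * g * V⁻¹) * Q (diagPhase ((1 - α) * t) * V) +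
        (1 - α) * (P (diagPhase (α * t) * g * V⁻¹) * Q₁ (diagPhase ((1 - α) * t) * V)))
        ∂(haarProbability SU2) :=
    funext fun t => convSU2_deriv_split_eq hPc hP hP₁ hQ hQ₁ hdP hdQ g α t
  -- its derivative at `0` is `(P₂ ⋆ Q)(g)` …
  have hA := hasDerivAt_fibre_convSU2 hP₁ hP₂ hQ hdP' g 0
  rw [hfun] at hA
  -- … and also the differentiated split
  have hc1 : Continuous fun p : ℝ × SU2 => diagPhase (α * p.1) * g * p.2⁻¹ :=
    ((continuous_diagPhase.comp (continuous_const.mul continuous_fst)).mul continuous_const).mul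
      continuous_snd.inv
  have hc2 : Continuous fun p : ℝ × SU2 => diagPhase ((1 - α) * p.1) * p.2 :=
    (continuous_diagPhase.comp (continuous_const.mul continuous_fst)).mul continuous_snd
  have hB := hasDerivAt_integral_haar
    (Φ := fun t V => α * P₁ (diagPhase (α * t) * g * V⁻¹) * Q (diagPhase ((1 - α) * t) * V) +
        (1 - α) * (P (diagPhase (α * t) * g * V⁻¹) * Q₁ (diagPhase ((1 - α) * t) * V)))
    (Φ' := fun t V => α ^ 2 * (P₂ (diagPhase (α * t) * g * V⁻¹) * Q (diagPhase ((1 - α) * t) * V)) +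
        2 * α * (1 - α) * (P₁ (diagPhase (α * t) * g * V⁻¹) * Q₁ (diagPhase ((1 - α) * t) * V)) +
        (1 - α) ^ 2 * (P (diagPhase (α * t) * g * V⁻¹) * Q₂ (diagPhase ((1 - α) * t) * V)))
    (((continuous_const.mul (hP₁.comp hc1)).mul (hQ.comp hc2)).add
      (continuous_const.mul ((hP.comp hc1).mul (hQ₁.comp hc2))))
    (((continuous_const.mul ((hP₂.comp hc1).mul (hQ.comp hc2))).add
      (continuous_const.mul ((hP₁.comp hc1).mul (hQ₁.comp hc2)))).add
      (continuous_const.mul ((hP.comp hc1).mul (hQ₂.comp hc2))))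
    (fun t V => by
      have h1 := hasDerivAt_fibre_scaled hdP (g * V⁻¹) α t
      have h1' := hasDerivAt_fibre_scaled hdP' (g * V⁻¹) α t
      have h2 := hasDerivAt_fibre_scaled hdQ V (1 - α) t
      have h2' := hasDerivAt_fibre_scaled hdQ' V (1 - α) t
      have h3 := ((h1'.mul h2).const_mul α).add ((h1.mul h2').const_mul (1 - α))
      refine h3.congr_of_eventuallyEq (Eventually.of_forall fun u => ?_) |>.congr_deriv ?_
      · simp only [Pi.add_apply, Pi.mul_apply, mul_assoc]
      · simp only [mul_assoc]
        ring) 0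
  have hE := hA.unique hB
  simpa [diagPhase_zero, mul_assoc] using hE


/-! ### §3. Ito's local-curvature step for `convSU2` (Ito (20)–(21)) -/

/-- Weighted Cauchy–Schwarz for Haar integrals: `(∫ φ w)² ≤ (∫ w)(∫ φ² w)` for `w ≥ 0`. [folklore] -/
private theorem sq_integral_mul_le_haar {φ w : SU2 → ℝ} (hφ : Continuous φ) (hw : Continuous w)
    (hw0 : ∀ V, 0 ≤ w V) :
    (∫ V, φ V * w V ∂(haarProbability SU2)) ^ 2 ≤
      (∫ V, w V ∂(haarProbability SU2)) * ∫ V, φ V ^ 2 * w V ∂(haarProbability SU2) := by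
  have hquad : ∀ x : ℝ, 0 ≤ (∫ V, w V ∂(haarProbability SU2)) * (x * x) +
      (-2 * ∫ V, φ V * w V ∂(haarProbability SU2)) * x +
        ∫ V, φ V ^ 2 * w V ∂(haarProbability SU2) := by
    intro x
    have h0 : 0 ≤ ∫ V, (x - φ V) ^ 2 * w V ∂(haarProbability SU2) :=
      integral_nonneg fun V => mul_nonneg (sq_nonneg _) (hw0 V)
    have h1 : ∫ V, (x - φ V) ^ 2 * w V ∂(haarProbability SU2) =
        (∫ V, w V ∂(haarProbability SU2)) * (x * x) +
          (-2 * ∫ V, φ V * w V ∂(haarProbability SU2)) * x +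
            ∫ V, φ V ^ 2 * w V ∂(haarProbability SU2) := by
      have e : ∀ V, (x - φ V) ^ 2 * w V =
          (x * x) * w V + (-2 * x) * (φ V * w V) + φ V ^ 2 * w V := fun V => by ring
      simp_rw [e]
      rw [integral_add, integral_add, integral_const_mul, integral_const_mul]
      · ring
      all_goals apply integrable_of_continuous; fun_prop
    linarith
  have hd := discrim_le_zero hquad
  rw [discrim] at hd
  nlinarith [hd]

/-- `∫ f(g V⁻¹) dV = ∫ f dV` (inversion and left invariance of Haar measure). [folklore] -/
private theorem integral_comp_mul_inv (f : SU2 → ℝ) (g : SU2) :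
    ∫ V, f (g * V⁻¹) ∂(haarProbability SU2) = ∫ V, f V ∂(haarProbability SU2) := by
  rw [integral_inv_eq_self (fun V => f (g * V)) (haarProbability SU2)]
  exact integral_mul_left_eq_self (μ := haarProbability SU2) f g

/-- **The local curvature has zero Haar mean**: `∫ (P₁² - P₂P)/P² dHaar = 0` for a positive `P` with
fibre derivatives `P₁`, `P₂` (it is minus the fibre derivative of `P₁/P`; Ito: «a periodic function of
`θ` such that `∫ β dθ = 0`»). [cite: Ito1987HierarchicalHeisenberg, §3 after eq. (21)] -/
theorem integral_curv_eq_zero {P P₁ P₂ : SU2 → ℝ} (hP : Continuous P) (hP₁ : Continuous P₁)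
    (hP₂ : Continuous P₂) (hpos : ∀ u, 0 < P u)
    (hdP : ∀ (g : SU2) (s : ℝ), HasDerivAt (fun t => P (diagPhase t * g)) (P₁ (diagPhase s * g)) s)
    (hdP' : ∀ (g : SU2) (s : ℝ), HasDerivAt (fun t => P₁ (diagPhase t * g)) (P₂ (diagPhase s * g)) s) :
    ∫ V, (P₁ V ^ 2 - P₂ V * P V) / P V ^ 2 ∂(haarProbability SU2) = 0 := by
  have hne : ∀ u, P u ≠ 0 := fun u => (hpos u).ne'
  have hq : ∀ (g : SU2) (s : ℝ), HasDerivAt (fun t => P₁ (diagPhase t * g) / P (diagPhase t * g))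
      (-((P₁ (diagPhase s * g) ^ 2 - P₂ (diagPhase s * g) * P (diagPhase s * g)) /
        P (diagPhase s * g) ^ 2)) s := by
    intro g s
    have h := (hdP' g s).div (hdP g s) (hne _)
    refine h.congr_deriv ?_
    ring
  have hc1 : Continuous fun u => P₁ u / P u := hP₁.div hP hne
  have hc2 : Continuous fun u => -((P₁ u ^ 2 - P₂ u * P u) / P u ^ 2) :=
    (((hP₁.pow 2).sub (hP₂.mul hP)).div (hP.pow 2) fun u => pow_ne_zero 2 (hne u)).neg
  have h0 := integral_fibreDeriv_eq_zero (F := fun u => P₁ u / P u)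
    (F₁ := fun u => -((P₁ u ^ 2 - P₂ u * P u) / P u ^ 2)) hc1 hc2 hq
  rw [integral_neg, neg_eq_zero] at h0
  exact h0

/-- Two-sided bounds on `(P ⋆ Q)(g)` from bounds on `P`, `Q` (Haar measure has mass one). [folklore] -/
private theorem convSU2_le {P Q : SU2 → ℝ} (hP : Continuous P) (hQ : Continuous Q) {mP MP MQ : ℝ}
    (hmP : ∀ u, mP ≤ P u) (hMP : ∀ u, P u ≤ MP) (hMQ : ∀ u, Q u ≤ MQ) (hmP0 : 0 ≤ mP)
    (hQ0 : ∀ u, 0 ≤ Q u) (g : SU2) : convSU2 P Q g ≤ MP * MQ := by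
  show (∫ V, P (g * V⁻¹) * Q V ∂(haarProbability SU2)) ≤ MP * MQ
  have hMP0 : 0 ≤ MP := hmP0.trans ((hmP 1).trans (hMP 1))
  calc (∫ V, P (g * V⁻¹) * Q V ∂(haarProbability SU2))
      ≤ ∫ V, MP * MQ ∂(haarProbability SU2) := by
        refine integral_mono (integrable_of_continuous (by fun_prop)) (integrable_const _)
          fun V => ?_
        exact mul_le_mul (hMP _) (hMQ _) (hQ0 _) hMP0
    _ = MP * MQ := by simp

/-- Lower bound `m_P m_Q ≤ (P ⋆ Q)(g)`. [folklore] -/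
private theorem le_convSU2 {P Q : SU2 → ℝ} (hP : Continuous P) (hQ : Continuous Q) {mP mQ : ℝ}
    (hmP : ∀ u, mP ≤ P u) (hmQ : ∀ u, mQ ≤ Q u) (hmP0 : 0 ≤ mP) (hmQ0 : 0 ≤ mQ) (g : SU2) :
    mP * mQ ≤ convSU2 P Q g := by
  show mP * mQ ≤ ∫ V, P (g * V⁻¹) * Q V ∂(haarProbability SU2)
  calc mP * mQ = ∫ V, mP * mQ ∂(haarProbability SU2) := by simp
    _ ≤ ∫ V, P (g * V⁻¹) * Q V ∂(haarProbability SU2) := by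
        refine integral_mono (integrable_const _) (integrable_of_continuous (by fun_prop))
          fun V => ?_
        exact mul_le_mul (hmP _) (hmQ _) hmQ0 (hmP0.trans (hmP _))

/-- **Ito's local-curvature step on `SU(2)`** (the heart of the proof): if the fibre curvatures
satisfy `b_P = (P₁² - P₂P)/P² ≤ B_P` (`B_P ≥ 0`) and `b_Q ≤ B_Q`, and `m_P ≤ P ≤ M_P`, `m_Q ≤ Q ≤ M_Q`
(`m_P, m_Q > 0`), `P` a class function, then `K = P ⋆ Q` satisfies, for every `α`,
`b_K ≤ α²(1 - ρ) B_P + (1 - α)² B_Q` with `ρ = m_P m_Q/(M_P M_Q)`: Cauchy–Schwarz in the split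
representation of `K₁`, `K₂` (Ito (19)–(20)), the gain `1 - ρ` from the zero Haar mean of `b_P`
(Ito (21) and the remark after it). [cite: Ito1987HierarchicalHeisenberg, §3 eqs. (19)–(21)] -/
theorem curv_convSU2 {P P₁ P₂ Q Q₁ Q₂ : SU2 → ℝ} (hPc : ∀ u v : SU2, P (v * u * v⁻¹) = P u)
    (hP : Continuous P) (hP₁ : Continuous P₁) (hP₂ : Continuous P₂) (hQ : Continuous Q)
    (hQ₁ : Continuous Q₁) (hQ₂ : Continuous Q₂)
    (hdP : ∀ (g : SU2) (s : ℝ), HasDerivAt (fun t => P (diagPhase t * g)) (P₁ (diagPhase s * g)) s)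
    (hdP' : ∀ (g : SU2) (s : ℝ), HasDerivAt (fun t => P₁ (diagPhase t * g)) (P₂ (diagPhase s * g)) s)
    (hdQ : ∀ (g : SU2) (s : ℝ), HasDerivAt (fun t => Q (diagPhase t * g)) (Q₁ (diagPhase s * g)) s)
    (hdQ' : ∀ (g : SU2) (s : ℝ), HasDerivAt (fun t => Q₁ (diagPhase t * g)) (Q₂ (diagPhase s * g)) s)
    {BP BQ mP MP mQ MQ : ℝ} (hBP : 0 ≤ BP)
    (hcP : ∀ u, P₁ u ^ 2 - P₂ u * P u ≤ BP * P u ^ 2)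
    (hcQ : ∀ u, Q₁ u ^ 2 - Q₂ u * Q u ≤ BQ * Q u ^ 2)
    (hmP : ∀ u, mP ≤ P u) (hMP : ∀ u, P u ≤ MP) (hmQ : ∀ u, mQ ≤ Q u) (hMQ : ∀ u, Q u ≤ MQ)
    (hmP0 : 0 < mP) (hmQ0 : 0 < mQ) (α : ℝ) (g : SU2) :
    convSU2 P₁ Q g ^ 2 - convSU2 P₂ Q g * convSU2 P Q g ≤
      (α ^ 2 * (1 - mP * mQ / (MP * MQ)) * BP + (1 - α) ^ 2 * BQ) * convSU2 P Q g ^ 2 := by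
  have hPpos : ∀ u, 0 < P u := fun u => hmP0.trans_le (hmP u)
  have hQpos : ∀ u, 0 < Q u := fun u => hmQ0.trans_le (hmQ u)
  have hPne : ∀ u, P u ≠ 0 := fun u => (hPpos u).ne'
  have hQne : ∀ u, Q u ≠ 0 := fun u => (hQpos u).ne'
  have hMP0 : 0 < MP := hmP0.trans_le ((hmP 1).trans (hMP 1))
  have hMQ0 : 0 < MQ := hmQ0.trans_le ((hmQ 1).trans (hMQ 1))
  -- bounds on K
  have hKle : convSU2 P Q g ≤ MP * MQ :=
    convSU2_le hP hQ hmP hMP hMQ hmP0.le (fun u => (hQpos u).le) g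
  have hKge : mP * mQ ≤ convSU2 P Q g := le_convSU2 hP hQ hmP hmQ hmP0.le hmQ0.le g
  have hKpos : 0 < convSU2 P Q g := lt_of_lt_of_le (mul_pos hmP0 hmQ0) hKge
  -- the weight and the test functions
  set w : SU2 → ℝ := fun V => P (g * V⁻¹) * Q V with hw
  have hw0 : ∀ V, 0 ≤ w V := fun V => (mul_pos (hPpos _) (hQpos _)).le
  have cgi : Continuous fun V : SU2 => g * V⁻¹ := continuous_const.mul continuous_inv
  have cw : Continuous w := (hP.comp cgi).mul hQ
  have hKw : convSU2 P Q g = ∫ V, w V ∂(haarProbability SU2) := rfl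
  set φ : SU2 → ℝ := fun V => α * (P₁ (g * V⁻¹) / P (g * V⁻¹)) + (1 - α) * (Q₁ V / Q V) with hφ
  have cφ : Continuous φ :=
    (continuous_const.mul ((hP₁.comp cgi).div (hP.comp cgi) fun V => hPne _)).add
      (continuous_const.mul (hQ₁.div hQ hQne))
  set ψ : SU2 → ℝ := fun V => α ^ 2 * (P₂ (g * V⁻¹) / P (g * V⁻¹)) +
      2 * α * (1 - α) * ((P₁ (g * V⁻¹) / P (g * V⁻¹)) * (Q₁ V / Q V)) +
        (1 - α) ^ 2 * (Q₂ V / Q V) with hψ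
  have cψ : Continuous ψ :=
    ((continuous_const.mul ((hP₂.comp cgi).div (hP.comp cgi) fun V => hPne _)).add
      (continuous_const.mul (((hP₁.comp cgi).div (hP.comp cgi) fun V => hPne _).mul
        (hQ₁.div hQ hQne)))).add (continuous_const.mul (hQ₂.div hQ hQne))
  -- ∫ φ w = K₁ and ∫ ψ w = K₂
  have Hφ : ∫ V, φ V * w V ∂(haarProbability SU2) = convSU2 P₁ Q g := by
    rw [convSU2_one_split hPc hP hP₁ hQ hQ₁ hdP hdQ g α]
    refine integral_congr_ae (Eventually.of_forall fun V => ?_)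
    have h1 := hPne (g * V⁻¹)
    have h2 := hQne V
    simp only [hφ, hw]
    field_simp
  have Hψ : ∫ V, ψ V * w V ∂(haarProbability SU2) = convSU2 P₂ Q g := by
    rw [convSU2_two_split hPc hP hP₁ hP₂ hQ hQ₁ hQ₂ hdP hdP' hdQ hdQ' g α]
    refine integral_congr_ae (Eventually.of_forall fun V => ?_)
    have h1 := hPne (g * V⁻¹)
    have h2 := hQne V
    simp only [hψ, hw]
    field_simp
  -- Cauchy–Schwarz
  have hCS := sq_integral_mul_le_haar cφ cw hw0
  rw [Hφ, ← hKw] at hCS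
  -- the curvature integrand
  set bP : SU2 → ℝ := fun u => (P₁ u ^ 2 - P₂ u * P u) / P u ^ 2 with hbP
  set bQ : SU2 → ℝ := fun u => (Q₁ u ^ 2 - Q₂ u * Q u) / Q u ^ 2 with hbQ
  have cbP : Continuous bP :=
    ((hP₁.pow 2).sub (hP₂.mul hP)).div (hP.pow 2) fun u => pow_ne_zero 2 (hPne u)
  have cbQ : Continuous bQ :=
    ((hQ₁.pow 2).sub (hQ₂.mul hQ)).div (hQ.pow 2) fun u => pow_ne_zero 2 (hQne u)
  have hbPle : ∀ u, bP u ≤ BP := fun u => by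
    rw [hbP, div_le_iff₀ (pow_pos (hPpos u) 2)]
    exact hcP u
  have hbQle : ∀ u, bQ u ≤ BQ := fun u => by
    rw [hbQ, div_le_iff₀ (pow_pos (hQpos u) 2)]
    exact hcQ u
  have hdiff : ∀ V, φ V ^ 2 * w V - ψ V * w V =
      α ^ 2 * (bP (g * V⁻¹) * w V) + (1 - α) ^ 2 * (bQ V * w V) := by
    intro V
    have h1 := hPne (g * V⁻¹)
    have h2 := hQne V
    simp only [hφ, hψ, hbP, hbQ, hw]
    field_simp
    ring
  have hint : (∫ V, φ V ^ 2 * w V ∂(haarProbability SU2)) - convSU2 P₂ Q g =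
      α ^ 2 * ∫ V, bP (g * V⁻¹) * w V ∂(haarProbability SU2) +
        (1 - α) ^ 2 * ∫ V, bQ V * w V ∂(haarProbability SU2) := by
    rw [← Hψ, ← integral_sub, ← integral_const_mul, ← integral_const_mul, ← integral_add]
    · exact integral_congr_ae (Eventually.of_forall hdiff)
    all_goals apply integrable_of_continuous; fun_prop
  -- the `Q` term
  have hQterm : ∫ V, bQ V * w V ∂(haarProbability SU2) ≤ BQ * convSU2 P Q g := by
    rw [hKw, ← integral_const_mul]
    exact integral_mono (integrable_of_continuous (cbQ.mul cw))
      (integrable_of_continuous (continuous_const.mul cw))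
      fun V => mul_le_mul_of_nonneg_right (hbQle V) (hw0 V)
  -- the `P` term with the gain
  have hzero : ∫ V, bP (g * V⁻¹) ∂(haarProbability SU2) = 0 := by
    rw [integral_comp_mul_inv bP g]
    exact integral_curv_eq_zero hP hP₁ hP₂ hPpos hdP hdP'
  have hPterm : ∫ V, bP (g * V⁻¹) * w V ∂(haarProbability SU2) ≤
      BP * (convSU2 P Q g - mP * mQ) := by
    have hsplit : ∫ V, bP (g * V⁻¹) * w V ∂(haarProbability SU2) =
        (∫ V, bP (g * V⁻¹) * (w V - mP * mQ) ∂(haarProbability SU2)) +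
          mP * mQ * ∫ V, bP (g * V⁻¹) ∂(haarProbability SU2) := by
      rw [← integral_const_mul, ← integral_add]
      · exact integral_congr_ae (Eventually.of_forall fun V => by ring)
      all_goals apply integrable_of_continuous; fun_prop
    rw [hsplit, hzero, mul_zero, add_zero]
    have hwm : ∀ V, mP * mQ ≤ w V := fun V =>
      mul_le_mul (hmP _) (hmQ _) hmQ0.le (hmP0.le.trans (hmP _))
    calc ∫ V, bP (g * V⁻¹) * (w V - mP * mQ) ∂(haarProbability SU2)
        ≤ ∫ V, BP * (w V - mP * mQ) ∂(haarProbability SU2) :=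
          integral_mono (integrable_of_continuous (by fun_prop))
            (integrable_of_continuous (by fun_prop))
            fun V => mul_le_mul_of_nonneg_right (hbPle _) (sub_nonneg.2 (hwm V))
      _ = BP * (convSU2 P Q g - mP * mQ) := by
          rw [integral_const_mul, integral_sub (integrable_of_continuous cw) (integrable_const _),
            ← hKw]
          simp
  -- assemble
  have hρK : BP * (convSU2 P Q g - mP * mQ) ≤
      BP * ((1 - mP * mQ / (MP * MQ)) * convSU2 P Q g) := by
    refine mul_le_mul_of_nonneg_left ?_ hBP
    have h1 : mP * mQ / (MP * MQ) * convSU2 P Q g ≤ mP * mQ := by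
      rw [div_mul_eq_mul_div, div_le_iff₀ (mul_pos hMP0 hMQ0)]
      exact mul_le_mul_of_nonneg_left hKle (mul_pos hmP0 hmQ0).le
    nlinarith
  have hmain : convSU2 P₁ Q g ^ 2 - convSU2 P₂ Q g * convSU2 P Q g ≤
      convSU2 P Q g * (α ^ 2 * (BP * ((1 - mP * mQ / (MP * MQ)) * convSU2 P Q g)) +
        (1 - α) ^ 2 * (BQ * convSU2 P Q g)) := by
    have h2 : convSU2 P₁ Q g ^ 2 - convSU2 P₂ Q g * convSU2 P Q g ≤
        convSU2 P Q g * ((∫ V, φ V ^ 2 * w V ∂(haarProbability SU2)) - convSU2 P₂ Q g) := by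
      nlinarith [hCS, hKpos]
    refine h2.trans (mul_le_mul_of_nonneg_left ?_ hKpos.le)
    rw [hint]
    gcongr
    · exact hPterm.trans hρK
  nlinarith [hmain, hKpos]

/-- Ito's step without the gain: `b_K ≤ α² B_P + (1 - α)² B_Q`. [cite: Ito1987HierarchicalHeisenberg, §3 eq. (20)] -/
theorem curv_convSU2' {P P₁ P₂ Q Q₁ Q₂ : SU2 → ℝ} (hPc : ∀ u v : SU2, P (v * u * v⁻¹) = P u)
    (hP : Continuous P) (hP₁ : Continuous P₁) (hP₂ : Continuous P₂) (hQ : Continuous Q)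
    (hQ₁ : Continuous Q₁) (hQ₂ : Continuous Q₂)
    (hdP : ∀ (g : SU2) (s : ℝ), HasDerivAt (fun t => P (diagPhase t * g)) (P₁ (diagPhase s * g)) s)
    (hdP' : ∀ (g : SU2) (s : ℝ), HasDerivAt (fun t => P₁ (diagPhase t * g)) (P₂ (diagPhase s * g)) s)
    (hdQ : ∀ (g : SU2) (s : ℝ), HasDerivAt (fun t => Q (diagPhase t * g)) (Q₁ (diagPhase s * g)) s)
    (hdQ' : ∀ (g : SU2) (s : ℝ), HasDerivAt (fun t => Q₁ (diagPhase t * g)) (Q₂ (diagPhase s * g)) s)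
    {BP BQ mP MP mQ MQ : ℝ} (hBP : 0 ≤ BP)
    (hcP : ∀ u, P₁ u ^ 2 - P₂ u * P u ≤ BP * P u ^ 2)
    (hcQ : ∀ u, Q₁ u ^ 2 - Q₂ u * Q u ≤ BQ * Q u ^ 2)
    (hmP : ∀ u, mP ≤ P u) (hMP : ∀ u, P u ≤ MP) (hmQ : ∀ u, mQ ≤ Q u) (hMQ : ∀ u, Q u ≤ MQ)
    (hmP0 : 0 < mP) (hmQ0 : 0 < mQ) (α : ℝ) (g : SU2) :
    convSU2 P₁ Q g ^ 2 - convSU2 P₂ Q g * convSU2 P Q g ≤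
      (α ^ 2 * BP + (1 - α) ^ 2 * BQ) * convSU2 P Q g ^ 2 := by
  refine (curv_convSU2 hPc hP hP₁ hP₂ hQ hQ₁ hQ₂ hdP hdP' hdQ hdQ' hBP hcP hcQ hmP hMP hmQ hMQ hmP0
    hmQ0 α g).trans ?_
  have hMP0 : 0 < MP := hmP0.trans_le ((hmP 1).trans (hMP 1))
  have hMQ0 : 0 < MQ := hmQ0.trans_le ((hmQ 1).trans (hMQ 1))
  have hρ : 0 ≤ mP * mQ / (MP * MQ) := by positivity
  have h1 : α ^ 2 * (1 - mP * mQ / (MP * MQ)) * BP ≤ α ^ 2 * BP := by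
    have : α ^ 2 * (1 - mP * mQ / (MP * MQ)) * BP =
        α ^ 2 * BP - α ^ 2 * BP * (mP * mQ / (MP * MQ)) := by ring
    rw [this]
    nlinarith [sq_nonneg α, mul_nonneg (mul_nonneg (sq_nonneg α) hBP) hρ]
  gcongr


/-! ### §4. From a curvature bound to `min F ≥ e^{-π²B/2} max F` (Ito (24), (9)) -/

/-- **Two-sided bound from a curvature bound** for a positive class function on `SU(2)`: if
`b_F ≤ B` along the `σ₃`-fibres (`B ≥ 0`) then `max F · e^{-Bπ²/2} ≤ F ≤ max F`. A class function is
a function of the central angle ((2.16) of Müller–Schiemann), i.e. of the fibre through `𝟙`, a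
`2π`-periodic even function of the angle to which the one-dimensional lemma of the tree's `U(1)` file
applies (Taylor at the maximiser, distance `≤ π`). [cite: Ito1987HierarchicalHeisenberg, §3 eq. (24)] -/
theorem exists_bounds_of_curv {F F₁ F₂ : SU2 → ℝ} (hFc : ∀ u v : SU2, F (v * u * v⁻¹) = F u)
    (hF₂ : Continuous F₂) (hpos : ∀ u, 0 < F u)
    (hdF : ∀ (g : SU2) (s : ℝ), HasDerivAt (fun t => F (diagPhase t * g)) (F₁ (diagPhase s * g)) s)
    (hdF' : ∀ (g : SU2) (s : ℝ), HasDerivAt (fun t => F₁ (diagPhase t * g)) (F₂ (diagPhase s * g)) s)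
    {B : ℝ} (hB : 0 ≤ B) (hc : ∀ u, F₁ u ^ 2 - F₂ u * F u ≤ B * F u ^ 2) :
    ∃ M, 0 < M ∧ (∀ u, F u ≤ M) ∧ ∀ u, M * Real.exp (-(B * π ^ 2 / 2)) ≤ F u := by
  have hnice : Ito.NiceFun (fun t => F (diagPhase t)) (fun t => F₁ (diagPhase t))
      (fun t => F₂ (diagPhase t)) :=
    { periodic := fun t => angular_periodic hFc t
      even := fun t => angular_even hFc t
      pos := fun t => hpos _
      hasDerivAt := fun t => by simpa using hdF 1 t
      hasDerivAt' := fun t => by simpa using hdF' 1 t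
      continuous'' := hF₂.comp continuous_diagPhase }
  obtain ⟨M, hM0, hle, hge⟩ := Ito.exists_bounds_of_curv hnice hB fun t => hc _
  refine ⟨M, hM0, fun u => ?_, fun u => ?_⟩
  · rw [eq216_arccos hFc u]; exact hle _
  · rw [eq216_arccos hFc u]; exact hge _

/-! ### §5. The two halves of a Migdal–Kadanoff step: the power `f ↦ f^m` and the convolutions -/

/-- First fibre derivative of `f^{k+2}`. [folklore] -/
private theorem hasDerivAt_fibre_powK {f f₁ : SU2 → ℝ} (k : ℕ)
    (h : ∀ (g : SU2) (s : ℝ), HasDerivAt (fun t => f (diagPhase t * g)) (f₁ (diagPhase s * g)) s)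
    (g : SU2) (s : ℝ) :
    HasDerivAt (fun t => f (diagPhase t * g) ^ (k + 2))
      (((k : ℝ) + 2) * f (diagPhase s * g) ^ (k + 1) * f₁ (diagPhase s * g)) s := by
  have := hasDerivAt_fibre_pow (k + 2) h g s
  simpa using this

/-- Second fibre derivative of `f^{k+2}`. [folklore] -/
private theorem hasDerivAt_fibre_powK' {f f₁ f₂ : SU2 → ℝ} (k : ℕ)
    (h : ∀ (g : SU2) (s : ℝ), HasDerivAt (fun t => f (diagPhase t * g)) (f₁ (diagPhase s * g)) s)
    (h' : ∀ (g : SU2) (s : ℝ), HasDerivAt (fun t => f₁ (diagPhase t * g)) (f₂ (diagPhase s * g)) s)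
    (g : SU2) (s : ℝ) :
    HasDerivAt (fun t => ((k : ℝ) + 2) * f (diagPhase t * g) ^ (k + 1) * f₁ (diagPhase t * g))
      (((k : ℝ) + 2) * (((k : ℝ) + 1) * f (diagPhase s * g) ^ k * f₁ (diagPhase s * g) ^ 2 +
        f (diagPhase s * g) ^ (k + 1) * f₂ (diagPhase s * g))) s := by
  have h1 : HasDerivAt (fun t => f (diagPhase t * g) ^ (k + 1))
      (((k : ℝ) + 1) * f (diagPhase s * g) ^ k * f₁ (diagPhase s * g)) s := by
    simpa using (h g s).fun_pow (k + 1)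
  have h2 := ((h1.fun_mul (h' g s)).const_mul ((k : ℝ) + 2))
  refine h2.congr_of_eventuallyEq (Eventually.of_forall fun t => ?_) |>.congr_deriv ?_
  · simp only [mul_assoc]
  · ring

/-- **The bond-moving half**: the curvature of `f^m` is `m` times that of `f` —
`(f^m)₁² - (f^m)₂ f^m = m f^{2m-2}(f₁² - f₂ f) ≤ (mB) (f^m)²`. [cite: Ito1987HierarchicalHeisenberg, §3 eq. (19)] -/
theorem curv_pow {f f₁ f₂ : SU2 → ℝ} (k : ℕ) (hpos : ∀ u, 0 < f u) {B : ℝ}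
    (hc : ∀ u, f₁ u ^ 2 - f₂ u * f u ≤ B * f u ^ 2) (u : SU2) :
    (((k : ℝ) + 2) * f u ^ (k + 1) * f₁ u) ^ 2 -
        ((k : ℝ) + 2) * (((k : ℝ) + 1) * f u ^ k * f₁ u ^ 2 + f u ^ (k + 1) * f₂ u) * f u ^ (k + 2) ≤
      (((k : ℝ) + 2) * B) * (f u ^ (k + 2)) ^ 2 := by
  have hk : (0 : ℝ) ≤ (k : ℝ) + 2 := by positivity
  have hf : 0 ≤ f u ^ (2 * k + 2) := pow_nonneg (hpos u).le _
  have key : (((k : ℝ) + 2) * f u ^ (k + 1) * f₁ u) ^ 2 -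
      ((k : ℝ) + 2) * (((k : ℝ) + 1) * f u ^ k * f₁ u ^ 2 + f u ^ (k + 1) * f₂ u) * f u ^ (k + 2) =
      ((k : ℝ) + 2) * f u ^ (2 * k + 2) * (f₁ u ^ 2 - f₂ u * f u) := by ring
  rw [key]
  calc ((k : ℝ) + 2) * f u ^ (2 * k + 2) * (f₁ u ^ 2 - f₂ u * f u)
      ≤ ((k : ℝ) + 2) * f u ^ (2 * k + 2) * (B * f u ^ 2) :=
        mul_le_mul_of_nonneg_left (hc u) (mul_nonneg hk hf)
    _ = (((k : ℝ) + 2) * B) * (f u ^ (k + 2)) ^ 2 := by ring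


/-- The convolution of two class functions is a class function. [folklore] -/
private theorem central_convSU2 {P Q : SU2 → ℝ} (hP : ∀ u v : SU2, P (v * u * v⁻¹) = P u)
    (hQ : ∀ u v : SU2, Q (v * u * v⁻¹) = Q u) (u v : SU2) :
    convSU2 P Q (v * u * v⁻¹) = convSU2 P Q u := by
  rw [convSU2_eq_haarConv]
  exact MullerSchiemann1987.Migdal.isCentral_haarConv hP hQ u v

/-- Unfolding of the tree's convolution powers. [folklore] -/
private theorem convPow_succ' (g : SU2 → ℝ) (k : ℕ) :
    convPow g (k + 1) = convSU2 (convPow g k) g := rfl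

/-- **The decimation half, step by step** (Ito (19)–(20) iterated without the gain): the `(j+1)`-fold
convolution power `Q^{⋆(j+1)}` of a positive class function with curvature `≤ B_Q` is a positive
class function with curvature `≤ B_Q/(j+1)` and `m_Q^{j+1} ≤ Q^{⋆(j+1)} ≤ M_Q^{j+1}` — convolving
`j+1` copies divides the curvature by `j+1`, exactly compensating the bond-moving factor at the
critical dimension. [cite: Ito1987HierarchicalHeisenberg, §3 eqs. (19)–(20)] -/
theorem convPow_spec {Q Q₁ Q₂ : SU2 → ℝ} (hQc : ∀ u v : SU2, Q (v * u * v⁻¹) = Q u)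
    (hQ : Continuous Q) (hQ₁ : Continuous Q₁) (hQ₂ : Continuous Q₂)
    (hdQ : ∀ (g : SU2) (s : ℝ), HasDerivAt (fun t => Q (diagPhase t * g)) (Q₁ (diagPhase s * g)) s)
    (hdQ' : ∀ (g : SU2) (s : ℝ), HasDerivAt (fun t => Q₁ (diagPhase t * g)) (Q₂ (diagPhase s * g)) s)
    {BQ mQ MQ : ℝ} (hBQ : 0 ≤ BQ) (hcQ : ∀ u, Q₁ u ^ 2 - Q₂ u * Q u ≤ BQ * Q u ^ 2)
    (hmQ : ∀ u, mQ ≤ Q u) (hMQ : ∀ u, Q u ≤ MQ) (hmQ0 : 0 < mQ) (j : ℕ) :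
    ∃ P₁ P₂ : SU2 → ℝ, (∀ u v : SU2, convPow Q j (v * u * v⁻¹) = convPow Q j u) ∧
      Continuous (convPow Q j) ∧ Continuous P₁ ∧ Continuous P₂ ∧
      (∀ (g : SU2) (s : ℝ),
        HasDerivAt (fun t => convPow Q j (diagPhase t * g)) (P₁ (diagPhase s * g)) s) ∧
      (∀ (g : SU2) (s : ℝ), HasDerivAt (fun t => P₁ (diagPhase t * g)) (P₂ (diagPhase s * g)) s) ∧
      (∀ u, mQ ^ (j + 1) ≤ convPow Q j u) ∧ (∀ u, convPow Q j u ≤ MQ ^ (j + 1)) ∧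
      ∀ u, P₁ u ^ 2 - P₂ u * convPow Q j u ≤ BQ / ((j : ℝ) + 1) * convPow Q j u ^ 2 := by
  induction j with
  | zero =>
    refine ⟨Q₁, Q₂, hQc, hQ, hQ₁, hQ₂, hdQ, hdQ', fun u => ?_, fun u => ?_, fun u => ?_⟩
    · simpa [convPow] using hmQ u
    · simpa [convPow] using hMQ u
    · simpa [convPow] using hcQ u
  | succ j ih =>
    obtain ⟨P₁, P₂, hPc, hP, hP₁, hP₂, hdP, hdP', hmP, hMP, hcP⟩ := ih
    have hmP0 : 0 < mQ ^ (j + 1) := pow_pos hmQ0 _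
    have hBP : 0 ≤ BQ / ((j : ℝ) + 1) := by positivity
    refine ⟨convSU2 P₁ Q, convSU2 P₂ Q, ?_, ?_, ?_, ?_, ?_, ?_, ?_, ?_, ?_⟩
    · intro u v
      rw [convPow_succ']
      exact central_convSU2 hPc hQc u v
    · rw [convPow_succ']; exact continuous_convSU2 hP hQ
    · exact continuous_convSU2 hP₁ hQ
    · exact continuous_convSU2 hP₂ hQ
    · intro g s
      exact hasDerivAt_fibre_convSU2 hP hP₁ hQ hdP g s
    · intro g s
      exact hasDerivAt_fibre_convSU2 hP₁ hP₂ hQ hdP' g s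
    · intro u
      rw [convPow_succ', pow_succ]
      exact le_convSU2 hP hQ hmP hmQ hmP0.le hmQ0.le u
    · intro u
      rw [convPow_succ', pow_succ]
      exact convSU2_le hP hQ hmP hMP hMQ hmP0.le (fun u => hmQ0.le.trans (hmQ u)) u
    · intro u
      rw [convPow_succ']
      have h := curv_convSU2' hPc hP hP₁ hP₂ hQ hQ₁ hQ₂ hdP hdP' hdQ hdQ' hBP hcP hcQ hmP hMP hmQ
        hMQ hmP0 hmQ0 (((j : ℝ) + 1) / ((j : ℝ) + 2)) u
      have hcoef : (((j : ℝ) + 1) / ((j : ℝ) + 2)) ^ 2 * (BQ / ((j : ℝ) + 1)) +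
          (1 - ((j : ℝ) + 1) / ((j : ℝ) + 2)) ^ 2 * BQ = BQ / (((j + 1 : ℕ) : ℝ) + 1) := by
        have h1 : (j : ℝ) + 1 ≠ 0 := by positivity
        have h2 : (j : ℝ) + 2 ≠ 0 := by positivity
        push_cast
        field_simp
        ring
      rw [hcoef] at h
      exact h

/-! ### §6. The Wilson datum: `e^{β Re tr U} = e^{2βu₀}` has curvature `2βu₀ ≤ 2β` -/

/-- `∂_t u₀(e^{-itσ₃} g) = u₃(e^{-itσ₃} g)`. [folklore] -/
private theorem hasDerivAt_u0_fibre (g : SU2) (s : ℝ) :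
    HasDerivAt (fun t => u0 (diagPhase t * g)) (u3 (diagPhase s * g)) s := by
  have hfun : (fun t => u0 (diagPhase t * g)) = fun t => u0 g * Real.cos t + u3 g * Real.sin t :=
    funext fun t => u0_diagPhase_mul t g
  rw [hfun, u3_diagPhase_mul]
  have h := ((Real.hasDerivAt_cos s).const_mul (u0 g)).add ((Real.hasDerivAt_sin s).const_mul (u3 g))
  refine h.congr_deriv ?_
  ring

/-- `∂_t u₃(e^{-itσ₃} g) = -u₀(e^{-itσ₃} g)`. [folklore] -/
private theorem hasDerivAt_u3_fibre (g : SU2) (s : ℝ) :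
    HasDerivAt (fun t => u3 (diagPhase t * g)) (-u0 (diagPhase s * g)) s := by
  have hfun : (fun t => u3 (diagPhase t * g)) = fun t => u3 g * Real.cos t - u0 g * Real.sin t :=
    funext fun t => u3_diagPhase_mul t g
  rw [hfun, u0_diagPhase_mul]
  have h := ((Real.hasDerivAt_cos s).const_mul (u3 g)).sub ((Real.hasDerivAt_sin s).const_mul (u0 g))
  refine h.congr_deriv ?_
  ring

/-- The Wilson weight in terms of `u₀`: `exp(β Re tr U) = exp(β (2u₀))`.
[cite: ItoSeiler2007Tomboulis, §2 eq. (2.1a)] -/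
theorem wilsonWeight_eq (β : ℝ) (U : SU2) : wilsonWeight β U = Real.exp (β * (2 * u0 U)) := by
  rw [wilsonWeight, ← trace_re_div_two]
  ring_nf

/-- **The initial datum of the recursion**: the Wilson weight `W = e^{2βu₀}` is a positive class
function, `C²` along the fibres with `W₁ = 2βu₃W`, `W₂ = (4β²u₃² - 2βu₀)W`, and local curvature
`b_W = 2βu₀ ≤ 2β` (Ito: the recursion starts at `g⁽⁰⁾ = exp[β((e, ve) - 1)]`).
[cite: Ito1987HierarchicalHeisenberg, §3 eq. (13) with §2 (1a)] -/
theorem wilsonWeight_spec {β : ℝ} (hβ : 0 ≤ β) :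
    (∀ u v : SU2, wilsonWeight β (v * u * v⁻¹) = wilsonWeight β u) ∧
    Continuous (wilsonWeight β) ∧
    Continuous (fun u => 2 * β * u3 u * wilsonWeight β u) ∧
    Continuous (fun u => (4 * β ^ 2 * u3 u ^ 2 - 2 * β * u0 u) * wilsonWeight β u) ∧
    (∀ u, 0 < wilsonWeight β u) ∧
    (∀ (g : SU2) (s : ℝ), HasDerivAt (fun t => wilsonWeight β (diagPhase t * g))
      (2 * β * u3 (diagPhase s * g) * wilsonWeight β (diagPhase s * g)) s) ∧
    (∀ (g : SU2) (s : ℝ), HasDerivAt (fun t => 2 * β * u3 (diagPhase t * g) * wilsonWeight β (diagPhase t * g))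
      ((4 * β ^ 2 * u3 (diagPhase s * g) ^ 2 - 2 * β * u0 (diagPhase s * g)) *
        wilsonWeight β (diagPhase s * g)) s) ∧
    ∀ u, (2 * β * u3 u * wilsonWeight β u) ^ 2 -
        (4 * β ^ 2 * u3 u ^ 2 - 2 * β * u0 u) * wilsonWeight β u * wilsonWeight β u ≤
      2 * β * wilsonWeight β u ^ 2 := by
  have hW : ∀ u, wilsonWeight β u = Real.exp (β * (2 * u0 u)) := wilsonWeight_eq β
  have hWf : wilsonWeight β = fun u => Real.exp (β * (2 * u0 u)) := funext hW
  have hc : Continuous (wilsonWeight β) := by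
    rw [hWf]; exact Real.continuous_exp.comp (continuous_const.mul (continuous_const.mul continuous_u0))
  have hd1 : ∀ (g : SU2) (s : ℝ), HasDerivAt (fun t => wilsonWeight β (diagPhase t * g))
      (2 * β * u3 (diagPhase s * g) * wilsonWeight β (diagPhase s * g)) s := by
    intro g s
    rw [hWf]
    have h := (((hasDerivAt_u0_fibre g s).const_mul 2).const_mul β).exp
    refine h.congr_deriv ?_
    ring
  refine ⟨fun u v => by rw [hW, hW, u0_conj], hc, ?_, ?_, fun u => by rw [hW]; exact Real.exp_pos _,
    hd1, ?_, fun u => ?_⟩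
  · exact ((continuous_const.mul continuous_u3).mul hc)
  · exact (((continuous_const.mul (continuous_u3.pow 2)).sub (continuous_const.mul continuous_u0)).mul hc)
  · intro g s
    have h := (((hasDerivAt_u3_fibre g s).const_mul (2 * β))).mul (hd1 g s)
    refine h.congr_deriv ?_
    ring
  · have h1 : u0 u ≤ 1 := (abs_le.mp (abs_u0_le_one u)).2
    have h2 : 0 < wilsonWeight β u := by rw [hW]; exact Real.exp_pos _
    nlinarith [mul_nonneg hβ (pow_pos h2 2).le, mul_le_mul_of_nonneg_left h1 hβ]

/-! ### §7. The characters: `sup |χ_n| < ∞` and `∫ χ_n dHaar = 0` for `n ≠ 0` -/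

/-- A cyclic permutation of the three imaginary quaternion coordinates by an inner automorphism:
conjugation by `C = ½[[1+i, 1+i], [-1+i, 1-i]] ∈ SU(2)` (the unit quaternion `(1+i+j+k)/2`) fixes
`u₀`, sends `u₃ = Im U₀₀` to `Im U₀₁` and `Im U₀₁` to `Re U₀₁`. [folklore] -/
private theorem exists_cyclic_conj :
    ∃ C : SU2, ∀ U : SU2,
      u3 (C * U * C⁻¹) = (((U : Matrix (Fin 2) (Fin 2) ℂ) 0 1)).im ∧
      (((C * U * C⁻¹ : SU2) : Matrix (Fin 2) (Fin 2) ℂ) 0 1).im =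
        (((U : Matrix (Fin 2) (Fin 2) ℂ) 0 1)).re := by
  let M : Matrix (Fin 2) (Fin 2) ℂ :=
    !![(⟨1 / 2, 1 / 2⟩ : ℂ), (⟨1 / 2, 1 / 2⟩ : ℂ); (⟨-1 / 2, 1 / 2⟩ : ℂ), (⟨1 / 2, -1 / 2⟩ : ℂ)]
  have hM : M ∈ Matrix.specialUnitaryGroup (Fin 2) ℂ := by
    rw [Matrix.mem_specialUnitaryGroup_iff, Matrix.mem_unitaryGroup_iff]
    refine ⟨?_, ?_⟩
    · ext i j
      fin_cases i <;> fin_cases j <;>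
        simp [M, Matrix.mul_apply, Fin.sum_univ_two, Matrix.star_apply, Complex.ext_iff,
          Complex.conj_re, Complex.conj_im] <;> norm_num
    · rw [Matrix.det_fin_two_of]
      simp [Complex.ext_iff]
      norm_num
  refine ⟨⟨M, hM⟩, fun U => ?_⟩
  have h10 := su2_apply_10 U
  have h11 := su2_apply_11 U
  have hcoe : ((⟨M, hM⟩ * U * (⟨M, hM⟩ : SU2)⁻¹ : SU2) : Matrix (Fin 2) (Fin 2) ℂ) =
      M * (U : Matrix (Fin 2) (Fin 2) ℂ) * star M := by
    rw [← Matrix.star_eq_inv]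
    rfl
  set a := (U : Matrix (Fin 2) (Fin 2) ℂ) 0 0 with ha
  set b := (U : Matrix (Fin 2) (Fin 2) ℂ) 0 1 with hb
  constructor
  · rw [u3, hcoe]
    simp only [Matrix.mul_apply, Fin.sum_univ_two, Matrix.star_apply, M, h10, h11]
    simp [Complex.mul_re, Complex.mul_im, Complex.add_re, Complex.add_im]
    ring
  · rw [hcoe]
    simp only [Matrix.mul_apply, Fin.sum_univ_two, Matrix.star_apply, M, h10, h11]
    simp [Complex.mul_re, Complex.mul_im, Complex.add_re, Complex.add_im]
    ring


/-- `χ_n(U) = U_n(u₀(U))` (the character as a Chebyshev polynomial of the second kind in `u₀ = Re tr U/2`;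
Bröcker–tom Dieck II §5: the character of `V_n` at `e(t)` is `κ_n(t) = sin((n+1)t)/sin t`).
[cite: BrockerTomDieck1985, II §5, display before (5.2)] -/
theorem su2Char_eq_eval_u0 (n : ℕ) (U : SU2) :
    su2Char n U = (Polynomial.Chebyshev.U ℝ (n : ℤ)).eval (u0 U) := by
  rw [su2Char, trace_re_div_two]

/-- The characters are continuous. [folklore] -/
private theorem continuous_su2Char (n : ℕ) : Continuous (su2Char n) := by
  have h : su2Char n = fun U => (Polynomial.Chebyshev.U ℝ (n : ℤ)).eval (u0 U) :=
    funext (su2Char_eq_eval_u0 n)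
  rw [h]
  exact (Polynomial.continuous _).comp continuous_u0

/-- The characters are bounded on the compact group. [folklore] -/
private theorem exists_bound_su2Char (n : ℕ) : ∃ C, 0 ≤ C ∧ ∀ U : SU2, |su2Char n U| ≤ C := by
  obtain ⟨C, hC⟩ := isCompact_univ.exists_bound_of_continuousOn (continuous_su2Char n).continuousOn
  refine ⟨max C 0, le_max_right _ _, fun U => ?_⟩
  exact (Real.norm_eq_abs _ ▸ hC U (mem_univ U)).trans (le_max_left _ _)

/-- Exchangeability of the three imaginary coordinates against a function of `u₀` (conjugation
invariance of Haar measure). [folklore] -/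
private theorem integral_imag_sq_mul (φ : ℝ → ℝ) :
    (∫ U, u3 U ^ 2 * φ (u0 U) ∂(haarProbability SU2) =
      ∫ U, (((U : Matrix (Fin 2) (Fin 2) ℂ) 0 1)).im ^ 2 * φ (u0 U) ∂(haarProbability SU2)) ∧
    (∫ U, (((U : Matrix (Fin 2) (Fin 2) ℂ) 0 1)).im ^ 2 * φ (u0 U) ∂(haarProbability SU2) =
      ∫ U, (((U : Matrix (Fin 2) (Fin 2) ℂ) 0 1)).re ^ 2 * φ (u0 U) ∂(haarProbability SU2)) := by
  obtain ⟨C, hC⟩ := exists_cyclic_conj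
  constructor
  · have h1 := integral_haar_conj_eq (fun U : SU2 => u3 U ^ 2 * φ (u0 U)) C C⁻¹
    rw [← h1]
    refine integral_congr_ae (Eventually.of_forall fun U => ?_)
    show u3 (C * U * C⁻¹) ^ 2 * φ (u0 (C * U * C⁻¹)) = _
    rw [(hC U).1, u0_conj]
  · have h1 := integral_haar_conj_eq
      (fun U : SU2 => (((U : Matrix (Fin 2) (Fin 2) ℂ) 0 1)).im ^ 2 * φ (u0 U)) C C⁻¹
    rw [← h1]
    refine integral_congr_ae (Eventually.of_forall fun U => ?_)
    show (((C * U * C⁻¹ : SU2) : Matrix (Fin 2) (Fin 2) ℂ) 0 1).im ^ 2 * φ (u0 (C * U * C⁻¹)) = _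
    rw [(hC U).2, u0_conj]

/-- `3 ∫ u₃² φ(u₀) dHaar = ∫ (1 - u₀²) φ(u₀) dHaar` (`u₀² + u₃² + |U₀₁|² = 1` and exchangeability).
[folklore] -/
private theorem three_mul_integral_u3_sq_mul {φ : ℝ → ℝ} (hφ : Continuous φ) :
    3 * ∫ U, u3 U ^ 2 * φ (u0 U) ∂(haarProbability SU2) =
      ∫ U, (1 - u0 U ^ 2) * φ (u0 U) ∂(haarProbability SU2) := by
  obtain ⟨h1, h2⟩ := integral_imag_sq_mul φ
  have hpt : ∀ U : SU2, (1 - u0 U ^ 2) * φ (u0 U) =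
      u3 U ^ 2 * φ (u0 U) + (((U : Matrix (Fin 2) (Fin 2) ℂ) 0 1)).im ^ 2 * φ (u0 U) +
        (((U : Matrix (Fin 2) (Fin 2) ℂ) 0 1)).re ^ 2 * φ (u0 U) := by
    intro U
    have h := normSq_add_normSq U
    rw [Complex.normSq_apply, Complex.normSq_apply] at h
    have hu0 : u0 U = ((U : Matrix (Fin 2) (Fin 2) ℂ) 0 0).re := rfl
    have hu3 : u3 U = ((U : Matrix (Fin 2) (Fin 2) ℂ) 0 0).im := rfl
    rw [hu0, hu3]
    linear_combination (-(φ ((U : Matrix (Fin 2) (Fin 2) ℂ) 0 0).re)) * h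
  have hc01 : Continuous fun U : SU2 => ((U : Matrix (Fin 2) (Fin 2) ℂ) 0 1) :=
    continuous_subtype_val.matrix_elem 0 1
  have cφ : Continuous fun U : SU2 => φ (u0 U) := hφ.comp continuous_u0
  have i1 : Integrable (fun U : SU2 => u3 U ^ 2 * φ (u0 U)) (haarProbability SU2) :=
    ((continuous_u3.pow 2).mul cφ).integrable_of_hasCompactSupport
      (HasCompactSupport.of_compactSpace _)
  have i2 : Integrable (fun U : SU2 => (((U : Matrix (Fin 2) (Fin 2) ℂ) 0 1)).im ^ 2 * φ (u0 U))
      (haarProbability SU2) :=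
    (((Complex.continuous_im.comp hc01).pow 2).mul cφ).integrable_of_hasCompactSupport
      (HasCompactSupport.of_compactSpace _)
  have i3 : Integrable (fun U : SU2 => (((U : Matrix (Fin 2) (Fin 2) ℂ) 0 1)).re ^ 2 * φ (u0 U))
      (haarProbability SU2) :=
    (((Complex.continuous_re.comp hc01).pow 2).mul cφ).integrable_of_hasCompactSupport
      (HasCompactSupport.of_compactSpace _)
  simp_rw [hpt]
  rw [integral_add _ i3, integral_add i1 i2, ← h2, ← h1]
  · ring
  · exact i1.add i2

/-- **Stein identity along the `σ₃`-fibres for a polynomial of `u₀`**: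
`∫ [ψ″(u₀) u₃² - ψ′(u₀) u₀] dHaar = 0` (zero Haar mean of the second fibre derivative of `ψ(u₀)`).
[folklore] -/
private theorem integral_stein (ψ : Polynomial ℝ) :
    ∫ U, ((Polynomial.derivative (Polynomial.derivative ψ)).eval (u0 U) * u3 U ^ 2 -
        (Polynomial.derivative ψ).eval (u0 U) * u0 U) ∂(haarProbability SU2) = 0 := by
  set ψ' := Polynomial.derivative ψ with hψ'
  set ψ'' := Polynomial.derivative ψ' with hψ''
  have hd1 : ∀ (g : SU2) (s : ℝ), HasDerivAt (fun t => ψ.eval (u0 (diagPhase t * g)))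
      (ψ'.eval (u0 (diagPhase s * g)) * u3 (diagPhase s * g)) s := fun g s =>
    (ψ.hasDerivAt _).comp s (hasDerivAt_u0_fibre g s)
  have hd2 : ∀ (g : SU2) (s : ℝ),
      HasDerivAt (fun t => ψ'.eval (u0 (diagPhase t * g)) * u3 (diagPhase t * g))
        (ψ''.eval (u0 (diagPhase s * g)) * u3 (diagPhase s * g) ^ 2 -
          ψ'.eval (u0 (diagPhase s * g)) * u0 (diagPhase s * g)) s := by
    intro g s
    have h := ((ψ'.hasDerivAt _).comp s (hasDerivAt_u0_fibre g s)).mul (hasDerivAt_u3_fibre g s)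
    refine h.congr_deriv ?_
    simp only [Function.comp]
    ring
  have hc1 : Continuous fun U : SU2 => ψ'.eval (u0 U) * u3 U :=
    ((Polynomial.continuous _).comp continuous_u0).mul continuous_u3
  have hc2 : Continuous fun U : SU2 => ψ''.eval (u0 U) * u3 U ^ 2 - ψ'.eval (u0 U) * u0 U :=
    (((Polynomial.continuous _).comp continuous_u0).mul (continuous_u3.pow 2)).sub
      (((Polynomial.continuous _).comp continuous_u0).mul continuous_u0)
  exact integral_fibreDeriv_eq_zero hc1 hc2 hd2


/-- The differential equation of the Chebyshev polynomials of the second kind, evaluated at a point: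
`(1 - x²) U_n″(x) = 3x U_n′(x) - n(n+2) U_n(x)` (Mathlib). [folklore] -/
private theorem chebyshevU_ode (n : ℤ) (x : ℝ) :
    (1 - x ^ 2) * (Polynomial.derivative (Polynomial.derivative (Polynomial.Chebyshev.U ℝ n))).eval x =
      3 * x * (Polynomial.derivative (Polynomial.Chebyshev.U ℝ n)).eval x -
        ((n : ℝ) + 2) * n * (Polynomial.Chebyshev.U ℝ n).eval x := by
  have h := congrArg (Polynomial.eval x)
    (Polynomial.Chebyshev.one_sub_X_sq_mul_derivative_derivative_U_eq_poly_in_U (R := ℝ) n)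
  simp only [Function.iterate_succ, Function.iterate_zero, Function.comp_apply, id,
    Polynomial.eval_mul, Polynomial.eval_sub, Polynomial.eval_add, Polynomial.eval_pow,
    Polynomial.eval_X, Polynomial.eval_one, Polynomial.eval_ofNat, Polynomial.eval_intCast] at h
  linear_combination h

/-- **Haar orthogonality of a non-trivial character to the constants**: `∫ χ_n dHaar = 0` for
`n ≠ 0` (Schur orthogonality against the trivial character). Proof here, avoiding the Weyl
integration formula: the Stein identity with `ψ = U_n`, the exchangeability
`3∫u₃²ψ″(u₀) = ∫(1-u₀²)ψ″(u₀)` and the Chebyshev equation give `n(n+2) ∫ U_n(u₀) dHaar = 0`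
(Bröcker–tom Dieck, proof of II (5.2): «we know from (4.11) that … ∫χ_n = 0 for n > 0»).
[cite: BrockerTomDieck1985, II (4.11)(i) and proof of II (5.2)] -/
theorem integral_su2Char_eq_zero {n : ℕ} (hn : n ≠ 0) :
    ∫ U, su2Char n U ∂(haarProbability SU2) = 0 := by
  set ψ := Polynomial.Chebyshev.U ℝ (n : ℤ) with hψ
  set ψ' := Polynomial.derivative ψ with hψ'
  set ψ'' := Polynomial.derivative ψ' with hψ''
  have cψ : ∀ p : Polynomial ℝ, Continuous fun U : SU2 => p.eval (u0 U) := fun p =>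
    (Polynomial.continuous _).comp continuous_u0
  have integ : ∀ {f : SU2 → ℝ}, Continuous f → Integrable f (haarProbability SU2) := fun hf =>
    hf.integrable_of_hasCompactSupport (HasCompactSupport.of_compactSpace _)
  have iA : Integrable (fun U : SU2 => ψ''.eval (u0 U) * u3 U ^ 2) (haarProbability SU2) :=
    integ ((cψ _).mul (continuous_u3.pow 2))
  have iB : Integrable (fun U : SU2 => ψ'.eval (u0 U) * u0 U) (haarProbability SU2) :=
    integ ((cψ _).mul continuous_u0)
  have iI : Integrable (fun U : SU2 => ψ.eval (u0 U)) (haarProbability SU2) := integ (cψ _)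
  -- Stein: ∫ ψ''(u0) u3² = ∫ ψ'(u0) u0
  have hS := integral_stein ψ
  rw [integral_sub iA iB, sub_eq_zero] at hS
  -- exchangeability: 3 ∫ u3² ψ''(u0) = ∫ (1 - u0²) ψ''(u0)
  have hE := three_mul_integral_u3_sq_mul (φ := fun x => ψ''.eval x) (Polynomial.continuous _)
  -- the ODE pointwise
  have hO : ∀ U : SU2, (1 - u0 U ^ 2) * ψ''.eval (u0 U) =
      3 * (ψ'.eval (u0 U) * u0 U) - (((n : ℝ) + 2) * n) * ψ.eval (u0 U) := by
    intro U
    have h := chebyshevU_ode (n : ℤ) (u0 U)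
    simp only [Int.cast_natCast] at h
    rw [hψ'', hψ', hψ]
    linear_combination h
  have hL : ∫ U, u3 U ^ 2 * ψ''.eval (u0 U) ∂(haarProbability SU2) =
      ∫ U, ψ''.eval (u0 U) * u3 U ^ 2 ∂(haarProbability SU2) :=
    integral_congr_ae (Eventually.of_forall fun U => mul_comm _ _)
  have hR : ∫ U, (1 - u0 U ^ 2) * ψ''.eval (u0 U) ∂(haarProbability SU2) =
      3 * ∫ U, ψ'.eval (u0 U) * u0 U ∂(haarProbability SU2) -
        (((n : ℝ) + 2) * n) * ∫ U, ψ.eval (u0 U) ∂(haarProbability SU2) := by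
    rw [← integral_const_mul, ← integral_const_mul, ← integral_sub (iB.const_mul _) (iI.const_mul _)]
    exact integral_congr_ae (Eventually.of_forall hO)
  rw [hL, hR, hS] at hE
  have hc : ((n : ℝ) + 2) * n ≠ 0 := by
    have : (0 : ℝ) < n := by exact_mod_cast Nat.pos_of_ne_zero hn
    positivity
  have hI : ∫ U, ψ.eval (u0 U) ∂(haarProbability SU2) = 0 := by
    have h3 : (((n : ℝ) + 2) * n) * ∫ U, ψ.eval (u0 U) ∂(haarProbability SU2) = 0 := by linarith
    exact (mul_eq_zero.mp h3).resolve_left hc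
  have hchar : (fun U : SU2 => su2Char n U) = fun U => ψ.eval (u0 U) := funext fun U => by
    rw [su2Char_eq_eval_u0]
  rw [hchar]
  exact hI

/-! ### §8. One full Migdal–Kadanoff step contracts the curvature bound (Ito (21)–(22)) -/

/-- The gain of the last convolution, as a number: `ρ = e^{-(k+2)² Bπ²/2}`. [folklore] -/
private theorem rho_eq (k : ℕ) {M B : ℝ} (hM : 0 < M) :
    ((M * Real.exp (-(B * π ^ 2 / 2))) ^ (k + 2)) ^ (k + 1) * (M * Real.exp (-(B * π ^ 2 / 2))) ^ (k + 2) /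
        ((M ^ (k + 2)) ^ (k + 1) * M ^ (k + 2)) =
      Real.exp (-(((k : ℝ) + 2) ^ 2 * (B * π ^ 2 / 2))) := by
  have hM' : M ^ ((k + 2) * (k + 2)) ≠ 0 := pow_ne_zero _ hM.ne'
  have h1 : ((M * Real.exp (-(B * π ^ 2 / 2))) ^ (k + 2)) ^ (k + 1) *
      (M * Real.exp (-(B * π ^ 2 / 2))) ^ (k + 2) =
      M ^ ((k + 2) * (k + 2)) * Real.exp (-(B * π ^ 2 / 2)) ^ ((k + 2) * (k + 2)) := by
    rw [← pow_succ, ← pow_mul, mul_pow]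
  have h2 : (M ^ (k + 2)) ^ (k + 1) * M ^ (k + 2) = M ^ ((k + 2) * (k + 2)) := by
    rw [← pow_succ, ← pow_mul]
  rw [h1, h2, mul_div_cancel_left₀ _ hM', ← Real.exp_nat_mul]
  congr 1
  push_cast
  ring

/-- **One Migdal–Kadanoff step** `f ↦ (f^{b²})^{⋆ b²}` (`b² = k + 2`, unnormalised) on a positive class
function with fibre-curvature `≤ B` produces a positive class function with fibre-curvature
`≤ B (1 - ½ e^{-(k+2)² Bπ²/2})`: the bond-moving power multiplies the curvature by `b²` (Ito (19)),
the `b²` convolutions divide it by `b²` (Ito (20)), and the zero mean of the curvature together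
with `min/max ≥ e^{-π²B/2}` yields the strict gain (Ito (21)–(22), (24)) — at the critical
dimension the marginal factors cancel exactly and only the gain survives.
[cite: Ito1987HierarchicalHeisenberg, §3 eqs. (19)–(24)] -/
theorem mkStep_spec {f f₁ f₂ : SU2 → ℝ} (k : ℕ) (hfc : ∀ u v : SU2, f (v * u * v⁻¹) = f u)
    (hf : Continuous f) (hf₁ : Continuous f₁) (hf₂ : Continuous f₂) (hpos : ∀ u, 0 < f u)
    (hdf : ∀ (g : SU2) (s : ℝ), HasDerivAt (fun t => f (diagPhase t * g)) (f₁ (diagPhase s * g)) s)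
    (hdf' : ∀ (g : SU2) (s : ℝ), HasDerivAt (fun t => f₁ (diagPhase t * g)) (f₂ (diagPhase s * g)) s)
    {B : ℝ} (hB : 0 ≤ B) (hc : ∀ u, f₁ u ^ 2 - f₂ u * f u ≤ B * f u ^ 2) :
    ∃ F₁ F₂ : SU2 → ℝ,
      (∀ u v : SU2, convPow (fun V => f V ^ (k + 2)) (k + 1) (v * u * v⁻¹) =
        convPow (fun V => f V ^ (k + 2)) (k + 1) u) ∧
      Continuous (convPow (fun V => f V ^ (k + 2)) (k + 1)) ∧ Continuous F₁ ∧ Continuous F₂ ∧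
      (∀ u, 0 < convPow (fun V => f V ^ (k + 2)) (k + 1) u) ∧
      (∀ (g : SU2) (s : ℝ), HasDerivAt (fun t => convPow (fun V => f V ^ (k + 2)) (k + 1) (diagPhase t * g))
        (F₁ (diagPhase s * g)) s) ∧
      (∀ (g : SU2) (s : ℝ), HasDerivAt (fun t => F₁ (diagPhase t * g)) (F₂ (diagPhase s * g)) s) ∧
      ∀ u, F₁ u ^ 2 - F₂ u * convPow (fun V => f V ^ (k + 2)) (k + 1) u ≤
        (B * (1 - Real.exp (-(((k : ℝ) + 2) ^ 2 * (B * π ^ 2 / 2))) / 2)) *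
          convPow (fun V => f V ^ (k + 2)) (k + 1) u ^ 2 := by
  -- the power `Q = f^{k+2}` and its fibre derivatives
  set Q : SU2 → ℝ := fun V => f V ^ (k + 2) with hQdef
  set Q₁ : SU2 → ℝ := fun u => ((k : ℝ) + 2) * f u ^ (k + 1) * f₁ u with hQ₁def
  set Q₂ : SU2 → ℝ := fun u =>
    ((k : ℝ) + 2) * (((k : ℝ) + 1) * f u ^ k * f₁ u ^ 2 + f u ^ (k + 1) * f₂ u) with hQ₂def
  have hQc : ∀ u v : SU2, Q (v * u * v⁻¹) = Q u := fun u v => by simp only [hQdef, hfc]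
  have hQ : Continuous Q := hf.pow _
  have hQ₁ : Continuous Q₁ := (continuous_const.mul (hf.pow _)).mul hf₁
  have hQ₂ : Continuous Q₂ :=
    continuous_const.mul (((continuous_const.mul (hf.pow _)).mul (hf₁.pow _)).add ((hf.pow _).mul hf₂))
  have hdQ : ∀ (g : SU2) (s : ℝ), HasDerivAt (fun t => Q (diagPhase t * g)) (Q₁ (diagPhase s * g)) s :=
    fun g s => hasDerivAt_fibre_powK k hdf g s
  have hdQ' : ∀ (g : SU2) (s : ℝ), HasDerivAt (fun t => Q₁ (diagPhase t * g)) (Q₂ (diagPhase s * g)) s :=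
    fun g s => hasDerivAt_fibre_powK' k hdf hdf' g s
  have hcQ : ∀ u, Q₁ u ^ 2 - Q₂ u * Q u ≤ (((k : ℝ) + 2) * B) * Q u ^ 2 := fun u => curv_pow k hpos hc u
  -- bounds on `f`, hence on `Q`
  obtain ⟨M, hM0, hfle, hfge⟩ := exists_bounds_of_curv hfc hf₂ hpos hdf hdf' hB hc
  set m : ℝ := M * Real.exp (-(B * π ^ 2 / 2)) with hmdef
  have hm0 : 0 < m := mul_pos hM0 (Real.exp_pos _)
  have hmQ : ∀ u, m ^ (k + 2) ≤ Q u := fun u => pow_le_pow_left₀ hm0.le (hfge u) _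
  have hMQ : ∀ u, Q u ≤ M ^ (k + 2) := fun u => pow_le_pow_left₀ (hpos u).le (hfle u) _
  have hmQ0 : 0 < m ^ (k + 2) := pow_pos hm0 _
  have hBQ : 0 ≤ ((k : ℝ) + 2) * B := by positivity
  -- the first `k + 1` factors: `P = Q^{⋆(k+1)}`
  obtain ⟨P₁, P₂, hPc, hP, hP₁, hP₂, hdP, hdP', hmP, hMP, hcP⟩ :=
    convPow_spec hQc hQ hQ₁ hQ₂ hdQ hdQ' hBQ hcQ hmQ hMQ hmQ0 k
  have hmP0 : 0 < (m ^ (k + 2)) ^ (k + 1) := pow_pos hmQ0 _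
  have hBP : 0 ≤ ((k : ℝ) + 2) * B / ((k : ℝ) + 1) := by positivity
  -- the last convolution, with the gain
  refine ⟨convSU2 P₁ Q, convSU2 P₂ Q, ?_, ?_, continuous_convSU2 hP₁ hQ, continuous_convSU2 hP₂ hQ,
    ?_, ?_, ?_, ?_⟩
  · intro u v
    rw [convPow_succ']
    exact central_convSU2 hPc hQc u v
  · rw [convPow_succ']; exact continuous_convSU2 hP hQ
  · intro u
    rw [convPow_succ']
    exact (mul_pos hmP0 hmQ0).trans_le (le_convSU2 hP hQ hmP hmQ hmP0.le hmQ0.le u)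
  · intro g s
    exact hasDerivAt_fibre_convSU2 hP hP₁ hQ hdP g s
  · intro g s
    exact hasDerivAt_fibre_convSU2 hP₁ hP₂ hQ hdP' g s
  · intro u
    rw [convPow_succ']
    have h := curv_convSU2 hPc hP hP₁ hP₂ hQ hQ₁ hQ₂ hdP hdP' hdQ hdQ' hBP hcP hcQ hmP hMP hmQ hMQ hmP0
      hmQ0 (((k : ℝ) + 1) / ((k : ℝ) + 2)) u
    have hρ := rho_eq k (B := B) hM0
    rw [← hmdef] at hρ
    set ρ : ℝ := (m ^ (k + 2)) ^ (k + 1) * m ^ (k + 2) / ((M ^ (k + 2)) ^ (k + 1) * M ^ (k + 2))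
      with hρdef
    have hρ0 : 0 ≤ ρ := by positivity
    have hcoef : (((k : ℝ) + 1) / ((k : ℝ) + 2)) ^ 2 * (1 - ρ) * (((k : ℝ) + 2) * B / ((k : ℝ) + 1)) +
        (1 - ((k : ℝ) + 1) / ((k : ℝ) + 2)) ^ 2 * (((k : ℝ) + 2) * B) =
        B * (1 - ρ * (((k : ℝ) + 1) / ((k : ℝ) + 2))) := by
      have h1 : (k : ℝ) + 1 ≠ 0 := by positivity
      have h2 : (k : ℝ) + 2 ≠ 0 := by positivity
      field_simp
      ring
    rw [hcoef] at h
    refine h.trans (mul_le_mul_of_nonneg_right ?_ (sq_nonneg _))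
    rw [← hρ]
    have hk : (1 : ℝ) / 2 ≤ ((k : ℝ) + 1) / ((k : ℝ) + 2) := by
      rw [div_le_div_iff₀ (by norm_num) (by positivity)]
      linarith [show (0 : ℝ) ≤ k from Nat.cast_nonneg k]
    nlinarith [mul_nonneg hB hρ0, mul_le_mul_of_nonneg_left hk (mul_nonneg hB hρ0)]


/-! ### §9. The iteration: `B_n ≤ 2β qⁿ → 0`, and the character coefficients -/

/-- Normalising by a positive constant preserves the fibre data and the curvature bound. [folklore] -/
private theorem normalise_spec {F F₁ F₂ : SU2 → ℝ} {Z B : ℝ} (hZ : 0 < Z)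
    (hFc : ∀ u v : SU2, F (v * u * v⁻¹) = F u) (hF : Continuous F) (hF₁ : Continuous F₁)
    (hF₂ : Continuous F₂) (hpos : ∀ u, 0 < F u)
    (hdF : ∀ (g : SU2) (s : ℝ), HasDerivAt (fun t => F (diagPhase t * g)) (F₁ (diagPhase s * g)) s)
    (hdF' : ∀ (g : SU2) (s : ℝ), HasDerivAt (fun t => F₁ (diagPhase t * g)) (F₂ (diagPhase s * g)) s)
    (hc : ∀ u, F₁ u ^ 2 - F₂ u * F u ≤ B * F u ^ 2) :
    (∀ u v : SU2, F (v * u * v⁻¹) / Z = F u / Z) ∧ Continuous (fun u => F u / Z) ∧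
      Continuous (fun u => F₁ u / Z) ∧ Continuous (fun u => F₂ u / Z) ∧ (∀ u, 0 < F u / Z) ∧
      (∀ (g : SU2) (s : ℝ), HasDerivAt (fun t => F (diagPhase t * g) / Z) (F₁ (diagPhase s * g) / Z) s) ∧
      (∀ (g : SU2) (s : ℝ), HasDerivAt (fun t => F₁ (diagPhase t * g) / Z) (F₂ (diagPhase s * g) / Z) s) ∧
      ∀ u, (F₁ u / Z) ^ 2 - F₂ u / Z * (F u / Z) ≤ B * (F u / Z) ^ 2 := by
  refine ⟨fun u v => by rw [hFc], hF.div_const _, hF₁.div_const _, hF₂.div_const _,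
    fun u => div_pos (hpos u) hZ, fun g s => (hdF g s).div_const Z, fun g s => (hdF' g s).div_const Z,
    fun u => ?_⟩
  have h := div_le_div_of_nonneg_right (hc u) (sq_nonneg Z)
  have hZ2 : Z ^ 2 ≠ 0 := pow_ne_zero 2 hZ.ne'
  calc (F₁ u / Z) ^ 2 - F₂ u / Z * (F u / Z) = (F₁ u ^ 2 - F₂ u * F u) / Z ^ 2 := by
        field_simp
    _ ≤ B * F u ^ 2 / Z ^ 2 := h
    _ = B * (F u / Z) ^ 2 := by field_simp

/-- **The invariant along the iteration** (Ito's Theorem 4 (1), quantified): the `n`-th iterate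
`f⁽ⁿ⁾` of the `D = 4` Migdal–Kadanoff recursion (scale factor `b ≥ 2`) started at Wilson's `SU(2)`
action is a positive, normalised class function, `C²` along the `σ₃`-fibres, whose local curvature
is bounded by `B_n ≤ 2β qⁿ` with `q = 1 - ½ e^{-b⁴βπ²} < 1` (`B₀ = 2β`; each step contracts by at
least `q` because `B_n ≤ B₀`). [cite: Ito1987HierarchicalHeisenberg, §3 Thm. 4 (1), eqs. (22)–(23)] -/
theorem mkIterFun_spec {b : ℕ} (hb : 2 ≤ b) {β : ℝ} (hβ : 0 < β) (n : ℕ) :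
    ∃ (B : ℝ) (f₁ f₂ : SU2 → ℝ), 0 ≤ B ∧
      B ≤ 2 * β * (1 - Real.exp (-(((b : ℝ) ^ 2) ^ 2 * (2 * β * π ^ 2 / 2))) / 2) ^ n ∧
      (∀ u v : SU2, mkIterFun b n (wilsonPlaqFn β) (v * u * v⁻¹) = mkIterFun b n (wilsonPlaqFn β) u) ∧
      Continuous (mkIterFun b n (wilsonPlaqFn β)) ∧ Continuous f₁ ∧ Continuous f₂ ∧
      (∀ u, 0 < mkIterFun b n (wilsonPlaqFn β) u) ∧
      (∀ (g : SU2) (s : ℝ), HasDerivAt (fun t => mkIterFun b n (wilsonPlaqFn β) (diagPhase t * g))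
        (f₁ (diagPhase s * g)) s) ∧
      (∀ (g : SU2) (s : ℝ), HasDerivAt (fun t => f₁ (diagPhase t * g)) (f₂ (diagPhase s * g)) s) ∧
      (∀ u, f₁ u ^ 2 - f₂ u * mkIterFun b n (wilsonPlaqFn β) u ≤
        B * mkIterFun b n (wilsonPlaqFn β) u ^ 2) ∧
      ∫ u, mkIterFun b n (wilsonPlaqFn β) u ∂(haarProbability SU2) = 1 := by
  -- the exponent `b² = k + 2`
  obtain ⟨k, hk⟩ : ∃ k : ℕ, b ^ 2 = k + 2 :=
    ⟨b ^ 2 - 2, by have := Nat.pow_le_pow_left hb 2; omega⟩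
  have hk1 : k + 2 - 1 = k + 1 := rfl
  have hkR : ((k : ℝ) + 2) = (b : ℝ) ^ 2 := by exact_mod_cast hk.symm
  set q : ℝ := 1 - Real.exp (-(((b : ℝ) ^ 2) ^ 2 * (2 * β * π ^ 2 / 2))) / 2 with hqdef
  induction n with
  | zero =>
    -- the Wilson datum, normalised
    obtain ⟨hWc, hW, hW₁, hW₂, hWpos, hdW, hdW', hcW⟩ := wilsonWeight_spec hβ.le
    set Z : ℝ := ∫ V, wilsonWeight β V ∂(haarProbability SU2) with hZdef
    have hZ : 0 < Z := by
      obtain ⟨m, hm⟩ : ∃ m, 0 < m ∧ ∀ u, m ≤ wilsonWeight β u := by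
        obtain ⟨u₀, -, hu₀⟩ := isCompact_univ.exists_isMinOn univ_nonempty hW.continuousOn
        exact ⟨_, hWpos u₀, fun u => hu₀ (mem_univ u)⟩
      calc (0 : ℝ) < m := hm.1
        _ = ∫ V, m ∂(haarProbability SU2) := by simp
        _ ≤ Z := integral_mono (integrable_const _) (integrable_of_continuous hW) hm.2
    obtain ⟨h1, h2, h3, h4, h5, h6, h7, h8⟩ := normalise_spec hZ hWc hW hW₁ hW₂ hWpos hdW hdW' hcW
    have hf0 : mkIterFun b 0 (wilsonPlaqFn β) = fun u => wilsonWeight β u / Z := by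
      rw [mkIterFun_zero]; rfl
    refine ⟨2 * β, _, _, by positivity, by simp, ?_, ?_, h3, h4, ?_, ?_, h7, ?_, ?_⟩
    · rw [hf0]; exact h1
    · rw [hf0]; exact h2
    · rw [hf0]; exact h5
    · rw [hf0]; exact h6
    · rw [hf0]; exact h8
    · rw [hf0]
      show (∫ u, wilsonWeight β u / Z ∂(haarProbability SU2)) = 1
      rw [integral_div, div_self hZ.ne']
  | succ n ih =>
    obtain ⟨B, f₁, f₂, hB, hBle, hfc, hf, hf₁, hf₂, hpos, hdf, hdf', hc, -⟩ := ih
    set f := mkIterFun b n (wilsonPlaqFn β) with hfdef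
    obtain ⟨F₁, F₂, hFc, hF, hF₁, hF₂, hFpos, hdF, hdF', hcF⟩ :=
      mkStep_spec k hfc hf hf₁ hf₂ hpos hdf hdf' hB hc
    set F := convPow (fun V => f V ^ (k + 2)) (k + 1) with hFdef
    set Z : ℝ := ∫ V, F V ∂(haarProbability SU2) with hZdef
    have hZ : 0 < Z := by
      obtain ⟨m, hm⟩ : ∃ m, 0 < m ∧ ∀ u, m ≤ F u := by
        obtain ⟨u₀, -, hu₀⟩ := isCompact_univ.exists_isMinOn univ_nonempty hF.continuousOn
        exact ⟨_, hFpos u₀, fun u => hu₀ (mem_univ u)⟩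
      calc (0 : ℝ) < m := hm.1
        _ = ∫ V, m ∂(haarProbability SU2) := by simp
        _ ≤ Z := integral_mono (integrable_const _) (integrable_of_continuous hF) hm.2
    set B' : ℝ := B * (1 - Real.exp (-(((k : ℝ) + 2) ^ 2 * (B * π ^ 2 / 2))) / 2) with hB'def
    obtain ⟨h1, h2, h3, h4, h5, h6, h7, h8⟩ := normalise_spec hZ hFc hF hF₁ hF₂ hFpos hdF hdF' hcF
    have hstep : mkIterFun b (n + 1) (wilsonPlaqFn β) = fun u => F u / Z := by
      rw [mkIterFun_succ, ← hfdef]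
      funext u
      simp only [mkStepFun, hk, hk1, hFdef, hZdef]
    have hB'0 : 0 ≤ B' := by
      have : Real.exp (-(((k : ℝ) + 2) ^ 2 * (B * π ^ 2 / 2))) ≤ 1 :=
        Real.exp_le_one_iff.mpr (by
          have : 0 ≤ ((k : ℝ) + 2) ^ 2 * (B * π ^ 2 / 2) := by positivity
          linarith)
      have : 0 ≤ 1 - Real.exp (-(((k : ℝ) + 2) ^ 2 * (B * π ^ 2 / 2))) / 2 := by linarith
      exact mul_nonneg hB this
    have hq0 : 0 ≤ q := by
      have : Real.exp (-(((b : ℝ) ^ 2) ^ 2 * (2 * β * π ^ 2 / 2))) ≤ 1 :=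
        Real.exp_le_one_iff.mpr (by
          have : 0 ≤ ((b : ℝ) ^ 2) ^ 2 * (2 * β * π ^ 2 / 2) := by positivity
          linarith)
      rw [hqdef]; linarith
    have hBB0 : B ≤ 2 * β := by
      refine hBle.trans ?_
      have hq1 : q ≤ 1 := by
        rw [hqdef]; linarith [Real.exp_pos (-(((b : ℝ) ^ 2) ^ 2 * (2 * β * π ^ 2 / 2)))]
      have := pow_le_one₀ hq0 hq1 (n := n)
      nlinarith
    have hB'le : B' ≤ 2 * β * q ^ (n + 1) := by
      -- `B' = B (1 - ½ e^{-b⁴Bπ²/2}) ≤ B (1 - ½ e^{-b⁴(2β)π²/2}) = B q ≤ 2β qⁿ q`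
      have hexp : Real.exp (-(((b : ℝ) ^ 2) ^ 2 * (2 * β * π ^ 2 / 2))) ≤
          Real.exp (-(((k : ℝ) + 2) ^ 2 * (B * π ^ 2 / 2))) := by
        rw [Real.exp_le_exp, hkR, neg_le_neg_iff]
        have : 0 ≤ ((b : ℝ) ^ 2) ^ 2 * (π ^ 2 / 2) := by positivity
        nlinarith
      have h1' : B' ≤ B * q := by
        rw [hB'def, hqdef]
        refine mul_le_mul_of_nonneg_left ?_ hB
        linarith
      calc B' ≤ B * q := h1'
        _ ≤ 2 * β * q ^ n * q := mul_le_mul_of_nonneg_right hBle hq0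
        _ = 2 * β * q ^ (n + 1) := by ring
    refine ⟨B', _, _, hB'0, hB'le, ?_, ?_, h3, h4, ?_, ?_, h7, ?_, ?_⟩
    · rw [hstep]; exact h1
    · rw [hstep]; exact h2
    · rw [hstep]; exact h5
    · rw [hstep]; exact h6
    · rw [hstep]; exact h8
    · rw [hstep]
      show (∫ u, F u / Z ∂(haarProbability SU2)) = 1
      rw [integral_div, div_self hZ.ne']


/-! ### §10. The character coefficients tend to zero: Ito's theorem for `SU(2)`, `D = 4`, `r = 1` -/

/-- **Coefficient bound from the curvature bound** (Ito's Theorem 4 (2) with §4 (25)–(26)): for a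
positive normalised class function `f` (`∫ f = 1`) with fibre-curvature `≤ B`, every non-trivial
character coefficient satisfies `|c_j| ≤ C_j (1 - e^{-Bπ²/2})`, `C_j = sup|χ_j|/(j+1)`: indeed
`min f ≥ e^{-Bπ²/2} max f ≥ e^{-Bπ²/2}` and `∫ χ_j = 0`, so `c_j = ∫ (f - min f) χ_j/(j+1)`.
[cite: Ito1987HierarchicalHeisenberg, §3 Thm. 4 (2), eq. (24); §4 eqs. (25)–(26)] -/
theorem abs_charCoeff_le {f f₁ f₂ : SU2 → ℝ} (hfc : ∀ u v : SU2, f (v * u * v⁻¹) = f u)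
    (hf : Continuous f) (hf₂ : Continuous f₂) (hpos : ∀ u, 0 < f u)
    (hdf : ∀ (g : SU2) (s : ℝ), HasDerivAt (fun t => f (diagPhase t * g)) (f₁ (diagPhase s * g)) s)
    (hdf' : ∀ (g : SU2) (s : ℝ), HasDerivAt (fun t => f₁ (diagPhase t * g)) (f₂ (diagPhase s * g)) s)
    {B : ℝ} (hB : 0 ≤ B) (hc : ∀ u, f₁ u ^ 2 - f₂ u * f u ≤ B * f u ^ 2)
    (hint : ∫ u, f u ∂(haarProbability SU2) = 1) {j : ℕ} (hj : j ≠ 0) {C : ℝ}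
    (hC : ∀ U : SU2, |su2Char j U| ≤ C) :
    |charCoeff f j| ≤ C / ((j : ℝ) + 1) * (1 - Real.exp (-(B * π ^ 2 / 2))) := by
  obtain ⟨M, hM0, hle, hge⟩ := exists_bounds_of_curv hfc hf₂ hpos hdf hdf' hB hc
  set m : ℝ := M * Real.exp (-(B * π ^ 2 / 2)) with hmdef
  have hj1 : (0 : ℝ) < (j : ℝ) + 1 := by positivity
  have hC0 : 0 ≤ C := (abs_nonneg _).trans (hC 1)
  have cχ : Continuous (su2Char j) := continuous_su2Char j
  have iχ : Integrable (fun U => su2Char j U / ((j : ℝ) + 1)) (haarProbability SU2) :=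
    integrable_of_continuous (cχ.div_const _)
  have ifχ : Integrable (fun U => f U * (su2Char j U / ((j : ℝ) + 1))) (haarProbability SU2) :=
    integrable_of_continuous (hf.mul (cχ.div_const _))
  -- `1 = ∫ f ≤ M`, hence `m ≥ e^{-Bπ²/2}`
  have hM1 : 1 ≤ M := by
    rw [← hint]
    calc ∫ u, f u ∂(haarProbability SU2) ≤ ∫ u, M ∂(haarProbability SU2) :=
          integral_mono (integrable_of_continuous hf) (integrable_const _) hle
      _ = M := by simp
  have hm1 : Real.exp (-(B * π ^ 2 / 2)) ≤ m := by
    rw [hmdef]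
    nlinarith [Real.exp_pos (-(B * π ^ 2 / 2))]
  -- `c_j = ∫ (f - m) χ_j/(j+1)`
  have hsplit : charCoeff f j =
      ∫ U, (f U - m) * (su2Char j U / ((j : ℝ) + 1)) ∂(haarProbability SU2) := by
    rw [charCoeff]
    have h0 : ∫ U, m * (su2Char j U / ((j : ℝ) + 1)) ∂(haarProbability SU2) = 0 := by
      rw [integral_const_mul, integral_div, integral_su2Char_eq_zero hj, zero_div, mul_zero]
    have e : ∀ U, (f U - m) * (su2Char j U / ((j : ℝ) + 1)) =
        f U * (su2Char j U / ((j : ℝ) + 1)) - m * (su2Char j U / ((j : ℝ) + 1)) := fun U => by ring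
    simp_rw [e]
    rw [integral_sub ifχ (iχ.const_mul m), h0, sub_zero]
  rw [hsplit]
  calc |∫ U, (f U - m) * (su2Char j U / ((j : ℝ) + 1)) ∂(haarProbability SU2)|
      ≤ ∫ U, |(f U - m) * (su2Char j U / ((j : ℝ) + 1))| ∂(haarProbability SU2) :=
        abs_integral_le_integral_abs
    _ ≤ ∫ U, (f U - m) * (C / ((j : ℝ) + 1)) ∂(haarProbability SU2) := by
        refine integral_mono (integrable_of_continuous (by fun_prop))
          (integrable_of_continuous (by fun_prop)) fun U => ?_
        rw [abs_mul, abs_of_nonneg (sub_nonneg.2 (hge U)), abs_div,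
          abs_of_pos hj1]
        exact mul_le_mul_of_nonneg_left (div_le_div_of_nonneg_right (hC U) hj1.le)
          (sub_nonneg.2 (hge U))
    _ = (1 - m) * (C / ((j : ℝ) + 1)) := by
        rw [integral_mul_const, integral_sub (integrable_of_continuous hf) (integrable_const _), hint]
        simp
    _ ≤ C / ((j : ℝ) + 1) * (1 - Real.exp (-(B * π ^ 2 / 2))) := by
        rw [mul_comm]
        exact mul_le_mul_of_nonneg_left (by linarith) (div_nonneg hC0 hj1.le)

end ItoSU2

open ItoSU2 in
/-- **Ito's theorem, `SU(2)` half, `D = 4`, `r = 1` — the named fact `itoTheoremSU2` DISCHARGED**: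
for every integer scale factor `b ≥ 2` and every `β > 0`, the standard Migdal–Kadanoff iterates
`f⁽ⁿ⁾` started at the normalised Wilson plaquette function `e^{β Re tr U}/∫e^{β Re tr}` converge
coefficient-wise to the strong-coupling fixed point: `c_j(n) = ∫ f⁽ⁿ⁾ χ_j/d_j dU → 0` for every
`j ≠ 0` (Ito 1985, PRL 55, 558, as quoted in Ito–Seiler 2007 Thm. 2.1). PROOF (Ito, CMP 110 (1987) §3,
the local-curvature argument at the critical dimension, written there for `S²`-spins and «easily
extended», here on `SU(2)` class functions along the `σ₃`-fibres): the maximal fibre curvature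
`B_n` of `-log f⁽ⁿ⁾` obeys `B_{n+1} ≤ (1 - ½e^{-b⁴B_nπ²/2}) B_n` (`mkStep_spec`: ×`b²` under the power,
÷`b²` under the `b²` convolutions, strict gain from the zero Haar mean of the curvature), hence
`B_n ≤ 2β qⁿ → 0` (`mkIterFun_spec`), and `|c_j(n)| ≤ C_j(1 - e^{-B_nπ²/2}) → 0` (`abs_charCoeff_le`,
using `∫χ_j dHaar = 0`). No new definition, no new named fact.
[cite: ItoSeiler2007Tomboulis, §2 Thm. 2.1] [cite: Ito1987HierarchicalHeisenberg, §3 eqs. (13)–(24), Thm. 4]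
[cite: Ito1985MKConfinement, Theorem (as quoted by ItoSeiler2007Tomboulis Thm 2.1)] -/
theorem itoTheoremSU2_holds : itoTheoremSU2 := by
  intro b hb β hβ j hj
  obtain ⟨C, hC0, hC⟩ := exists_bound_su2Char j
  set q : ℝ := 1 - Real.exp (-(((b : ℝ) ^ 2) ^ 2 * (2 * β * π ^ 2 / 2))) / 2 with hqdef
  have hq0 : 0 ≤ q := by
    have : Real.exp (-(((b : ℝ) ^ 2) ^ 2 * (2 * β * π ^ 2 / 2))) ≤ 1 :=
      Real.exp_le_one_iff.mpr (by
        have : 0 ≤ ((b : ℝ) ^ 2) ^ 2 * (2 * β * π ^ 2 / 2) := by positivity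
        linarith)
    rw [hqdef]; linarith
  have hq1 : q < 1 := by
    rw [hqdef]; linarith [Real.exp_pos (-(((b : ℝ) ^ 2) ^ 2 * (2 * β * π ^ 2 / 2)))]
  -- the bound `|c_j(n)| ≤ C/(j+1) (1 - exp(-(2β qⁿ) π²/2))`
  have hbound : ∀ n, |charCoeff (mkIterFun b n (wilsonPlaqFn β)) j| ≤
      C / ((j : ℝ) + 1) * (1 - Real.exp (-(2 * β * q ^ n * π ^ 2 / 2))) := by
    intro n
    obtain ⟨B, f₁, f₂, hB, hBle, hfc, hf, -, hf₂, hpos, hdf, hdf', hc, hint⟩ := mkIterFun_spec hb hβ n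
    refine (abs_charCoeff_le hfc hf hf₂ hpos hdf hdf' hB hc hint hj hC).trans ?_
    refine mul_le_mul_of_nonneg_left ?_ (div_nonneg hC0 (by positivity))
    have : Real.exp (-(2 * β * q ^ n * π ^ 2 / 2)) ≤ Real.exp (-(B * π ^ 2 / 2)) := by
      rw [Real.exp_le_exp]
      nlinarith [Real.pi_pos, sq_nonneg π]
    linarith
  -- the right-hand side tends to zero
  have hlim : Tendsto (fun n : ℕ => C / ((j : ℝ) + 1) * (1 - Real.exp (-(2 * β * q ^ n * π ^ 2 / 2))))
      atTop (𝓝 0) := by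
    have hq := tendsto_pow_atTop_nhds_zero_of_lt_one hq0 hq1
    have h1 : Tendsto (fun n : ℕ => -(2 * β * q ^ n * π ^ 2 / 2)) atTop (𝓝 (-(2 * β * 0 * π ^ 2 / 2))) :=
      (((hq.const_mul (2 * β)).mul_const (π ^ 2)).div_const 2).neg
    have h2 := (Real.continuous_exp.tendsto _).comp h1
    have h3 := ((h2.const_sub 1).const_mul (C / ((j : ℝ) + 1)))
    simpa using h3
  exact squeeze_zero_norm (fun n => by simpa [Real.norm_eq_abs] using hbound n) hlim

end Tomboulis2007

end Literature.MathematicalPhysics.QuantumFieldTheory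

/-! ## Revision 1 (append-only, same seat): Ito's Theorem 4 (2) as printed — `lim g⁽ⁿ⁾(v) = 1` UNIFORMLY in `v`

The coefficient-wise statement `itoTheoremSU2` is what Ito–Seiler 2007 Thm. 2.1 quotes; Ito's own Theorem 4 (2)
(CMP 110 p. 243) is the uniform convergence of the iterates to the trivial fixed point, which the curvature bound
gives directly: `∫ f⁽ⁿ⁾ = 1` and `max f⁽ⁿ⁾ e^{-B_nπ²/2} ≤ f⁽ⁿ⁾ ≤ max f⁽ⁿ⁾` force `|f⁽ⁿ⁾ - 1| ≤ e^{B_nπ²/2} - 1 → 0`.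
-/

noncomputable section

open Real MeasureTheory Set Filter Function
open scoped Topology

namespace Literature.MathematicalPhysics.QuantumFieldTheory

namespace Tomboulis2007

/-- **Ito's Theorem 4 (2) for `SU(2)`, `D = 4`, `r = 1`**: the Migdal–Kadanoff iterates started at Wilson's
`SU(2)` action converge UNIFORMLY to the strong-coupling fixed point `f ≡ 1`: for every integer `b ≥ 2` and
`β > 0`, `sup_U |f⁽ⁿ⁾(U) - 1| ≤ e^{B_nπ²/2} - 1 → 0` («`lim g⁽ⁿ⁾(v) = 1`, uniformly in `v`»; Ito's (24)
`1 ≥ g⁽ⁿ⁾(v) ≥ exp[-(β⁽ⁿ⁾/2)θ²]` with the normalisation `∫ f⁽ⁿ⁾ = 1` of the tree's recursion in place of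
`g⁽ⁿ⁾(1) = 1`). [cite: Ito1987HierarchicalHeisenberg, §3 Thm. 4 (2), eq. (24)] -/
theorem mkIterFun_tendstoUniformly_one {b : ℕ} (hb : 2 ≤ b) {β : ℝ} (hβ : 0 < β) :
    TendstoUniformly (fun n => mkIterFun b n (wilsonPlaqFn β)) (fun _ => 1) atTop := by
  set q : ℝ := 1 - Real.exp (-(((b : ℝ) ^ 2) ^ 2 * (2 * β * π ^ 2 / 2))) / 2 with hqdef
  have hq0 : 0 ≤ q := by
    have : Real.exp (-(((b : ℝ) ^ 2) ^ 2 * (2 * β * π ^ 2 / 2))) ≤ 1 :=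
      Real.exp_le_one_iff.mpr (by
        have : 0 ≤ ((b : ℝ) ^ 2) ^ 2 * (2 * β * π ^ 2 / 2) := by positivity
        linarith)
    rw [hqdef]; linarith
  have hq1 : q < 1 := by
    rw [hqdef]; linarith [Real.exp_pos (-(((b : ℝ) ^ 2) ^ 2 * (2 * β * π ^ 2 / 2)))]
  -- the uniform bound `|f⁽ⁿ⁾ - 1| ≤ exp(2β qⁿ π²/2) - 1`
  have hbound : ∀ n (U : SU2), |mkIterFun b n (wilsonPlaqFn β) U - 1| ≤
      Real.exp (2 * β * q ^ n * π ^ 2 / 2) - 1 := by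
    intro n U
    obtain ⟨B, f₁, f₂, hB, hBle, hfc, hf, -, hf₂, hpos, hdf, hdf', hc, hint⟩ :=
      ItoSU2.mkIterFun_spec hb hβ n
    obtain ⟨M, hM0, hle, hge⟩ := ItoSU2.exists_bounds_of_curv hfc hf₂ hpos hdf hdf' hB hc
    set f := mkIterFun b n (wilsonPlaqFn β) with hfdef
    set r : ℝ := Real.exp (-(B * π ^ 2 / 2)) with hrdef
    have hr0 : 0 < r := Real.exp_pos _
    have hint' : Integrable f (haarProbability SU2) :=
      hf.integrable_of_hasCompactSupport (HasCompactSupport.of_compactSpace _)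
    have hM1 : 1 ≤ M := by
      rw [← hint]
      calc ∫ u, f u ∂(haarProbability SU2) ≤ ∫ u, M ∂(haarProbability SU2) :=
            integral_mono hint' (integrable_const _) hle
        _ = M := by simp
    have hMr : M * r ≤ 1 := by
      rw [← hint]
      calc M * r = ∫ u, M * r ∂(haarProbability SU2) := by simp
        _ ≤ ∫ u, f u ∂(haarProbability SU2) := integral_mono (integrable_const _) hint' hge
    have hrexp : Real.exp (B * π ^ 2 / 2) ≤ Real.exp (2 * β * q ^ n * π ^ 2 / 2) := by
      rw [Real.exp_le_exp]
      nlinarith [Real.pi_pos, sq_nonneg π]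
    have hrinv : r⁻¹ = Real.exp (B * π ^ 2 / 2) := by rw [hrdef, ← Real.exp_neg, neg_neg]
    have hM' : M ≤ r⁻¹ := by
      have h := (le_div_iff₀ hr0).mpr hMr
      rwa [one_div] at h
    have hr1 : r ≤ 1 := by
      rw [hrdef]
      exact Real.exp_le_one_iff.mpr (neg_nonpos.mpr (by positivity))
    have hinv : r⁻¹ * r = 1 := inv_mul_cancel₀ hr0.ne'
    rw [abs_le]
    constructor
    · -- `1 - f ≤ 1 - M r ≤ M (1 - r) ≤ r⁻¹ - 1`
      have h1 : M * r ≤ f U := hge U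
      have h2 : M - M * r ≤ r⁻¹ - 1 := by
        nlinarith [mul_le_mul_of_nonneg_right hM' (sub_nonneg.2 hr1)]
      linarith
    · have h1 : f U ≤ M := hle U
      linarith
  rw [Metric.tendstoUniformly_iff]
  intro ε hε
  have hlim : Tendsto (fun n : ℕ => Real.exp (2 * β * q ^ n * π ^ 2 / 2) - 1) atTop (𝓝 0) := by
    have hq := tendsto_pow_atTop_nhds_zero_of_lt_one hq0 hq1
    have h1 : Tendsto (fun n : ℕ => 2 * β * q ^ n * π ^ 2 / 2) atTop (𝓝 (2 * β * 0 * π ^ 2 / 2)) :=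
      ((hq.const_mul (2 * β)).mul_const (π ^ 2)).div_const 2
    have h2 := ((Real.continuous_exp.tendsto _).comp h1).sub_const 1
    simpa using h2
  filter_upwards [(tendsto_order.1 hlim).2 ε hε] with n hn U
  rw [Real.dist_eq, abs_sub_comm]
  exact (hbound n U).trans_lt hn

end Tomboulis2007

end Literature.MathematicalPhysics.QuantumFieldTheory

end
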